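import Literature.MathematicalPhysics.QuantumFieldTheory.Balaban1983to89.B5Hk163Strip

/-!
# `Balaban1983to89.B5G183Strip` — the fiber-matrix entries of `G = Δ_a⁻¹` ((1.83)–(1.84), `a = 1`), continued to a `k`-UNIFORM complex strip in a ZERO-FREE REGROUPED NORMAL FORM (analyticity input for the kernel of `G`, cell node X9)

T. Bałaban, *Propagators and renormalization transformations for lattice gauge theories. I*, Commun. Math.
Phys. **95**, 17–40 (1984) [`Balaban1984PropagatorsI`, cell paper B5], (1.83)–(1.84) p. 31 [PDF 15], the text
(1.85)–(1.88) p. 32 [PDF 16] and Proposition 1.1 p. 33 [PDF 17] (renders `1984-cmp95-propagators-rt-I-p015-x2.png`,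
`-p016-x2.png`, `-p017-x2.png`, read as images by this lineage; the verbatim transcription is the header of
`B5Prop11Bound`).  VERSION v1.1 = DOCSTRING-ONLY revision of v1 (p187581, commit 549524afb532): the CONTENT list now
names §7–§8, HONEST SCOPE (i) is brought in line with §7–§8 (cross-read finding D-1), two page locators corrected
(«p. 32–33»/«p. 33» → p. 32 for the (1.85)–(1.88) sentences, finding m-1); every declaration and proof is byte-identical to v1.  What the paper
PRINTS (verbatim, p. 31): «Ã_μ(p′+l) = (GJ)~_μ(p′+l) = 1/Δ(p′+l) · J̃_μ(p′+l)
 − a · conj[u(p′+l)v_μ(p′+l)]/Δ(p′+l) · φ_μ⁻¹(p′) Σ_{l′} u(p′+l′)v_μ(p′+l′)/Δ(p′+l′) · J̃_μ(p′+l′)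
 + [ ∂_μ(p′+l) conj[u(p′+l)]/Δ²(p′+l) · (Σ_{l″} |u(p′+l″)|²/Δ²(p′+l″))⁻¹ − a · conj[u(p′+l)v_μ(p′+l)]/Δ(p′+l) · φ_μ⁻¹(p′) ∂_{1,μ}(p′) ]
   · a⁻¹ (Σ_λ |∂_{1,λ}(p′)|²/φ_λ(p′))⁻¹
   · Σ_{l′,ν} [ (Σ_{l″} |u(p′+l″)|²/Δ²(p′+l″))⁻¹ u(p′+l′) conj[∂_ν(p′+l′)]/Δ²(p′+l′) − a · conj[∂_{1,ν}(p′)] φ_ν⁻¹(p′) u(p′+l′)v_ν(p′+l′)/Δ(p′+l′) ] J̃_ν(p′+l′),  (1.83)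
 for p′ ≠ 0, …, where φ_μ(p′) = 1 + a Σ_{l″} |u(p′+l″)|² |v_μ(p′+l″)|² / Δ(p′+l″) for p′ ≠ 0. (1.84)»;
p. 32 (the two cancellation sentences): «Owing to the cancellation of the terms with l′ = l, the above expression
can be extended by continuity to p′ = 0.» and «Again taking into account the cancellation of the terms with l″ = l the
above expression is well defined by continuity for p′ = 0, and we even get an additional factor Δ₀(p′). Because there
are two expressions in square brackets in the considered term, we get the additional factor Δ₀²(p′). This factor
multiplying the function between the square bracket expressions gives an inverse of the expression (1.86) which is
also well defined.»; Proposition 1.1 p. 33: «… depending on d only (if we put a = 1).»  The METHOD continued here: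
B5 p. 38 [PDF 22], the sentence before (1.126) («… the analyticity method of proving an exponential decay …»), exactly
as for (1.63) in `B5Hk163Strip` and for (1.66) in `B5Symbol166Strip`.

CITATION HEADER (lean-in-tree rule).  This module is a SUPPLEMENT, not a quotation: B5 prints neither a complex
continuation of (1.83) nor a strip width.  Everything below is `[folklore]` audit mathematics; `[cite: …]` tags mark
the location of printed TEXT only.  ABSOLUTE RULE honoured: no statement of the papers is used as a hypothesis; the
import is the kernel-proved tree module `B5Hk163Strip` (⇒ the whole b05 strip engine `B4Strip`/`B4StripCauchy`/
`B5Strip145*`/`B5Symbol166*`, and `B5Prop11Fiber` ⊃ `B5Prop11Bound` = the typed fiber matrix `Fiber.G` of (1.83)).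
No constant below (`kappaYG`, `kappaFG`, `kappa183`, `MFG`, …) is attributed to print.  `a = 1` throughout
(Prop. 1.1 «if we put a = 1»; the convention of `B5Bounds167Lattice`, `B5Symbol166`, `B5Hk163Strip`); `U = 1`.

THE PROBLEM AND THE REGROUPING.  Read factor by factor, (1.83) cannot be continued to any strip `|Im p′_ν| ≤ κ`
uniformly in `k`: `1/Δ(p′)` (the `l = l′ = 0` entry of the first term), `φ_μ⁻¹`, `(Σ_{l″}|u|²/Δ²(p′+l″))⁻¹`
(`= Δ²(p′)/𝒩`) and `(Σ_λ|∂_{1,λ}|²/φ_λ)⁻¹` all carry the complex zeros of `Δ(p′) = Σ_ν S_ξ(p′_ν)` inside every strip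
(`B4Strip.printed_factor_has_poles` is the sibling phenomenon for (1.45)).  But every power of `Δ(p′)` CANCELS in
each assembled matrix entry — this is the audit's reading of the two printed cancellation sentences quoted above.
With the b05 objects `Y_μ := B5Symbol166.Yc` (`= Δ(p′)φ^{(1.62)}_μ(p′)` on the torus), `𝒩 := B5Strip145.Ncal`
(`= Δ²(p′)·Σ_{l″}|u(p′+l″)|²/Δ²(p′+l″)`), `X_{≠0} := B5Strip145.Xne`, `R̃_μ := B5Symbol166.Rt`, `c_μ := B5Symbol166.cfac`,
and the NEW `G`-denominators of this file
  `Y^G_μ := Δ(p′) + Y_μ` (`= Δ(p′)·φ_μ` with `φ_μ` of (1.84), since (1.84) `= 1 + a·`(1.62), `a = 1`),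
  `R^G_μ := 1 + R̃_μ`, `F^G := U_0^d + Σ_λ S₁(p′_λ) Σ_{∅≠T⊆{λ′≠λ}} Δ^{|T|−1} Π_{T} R^G Π_{rest} c`
with the exact factorisation `E^G = Δ·F^G`, `E^G := Σ_λ S₁(p′_λ)Π_{λ′≠λ}Y^G_λ′` (§2, the b05 identity `E = Δ·F` with
`R̃ ↦ 1 + R̃`), the printed scalar between the square brackets is `a⁻¹(Σ_λ|∂_{1,λ}|²/φ_λ)⁻¹ = Π_νY^G_ν/(Δ²(p′)F^G)`,
and the `(l,μ),(l′,ν)` ENTRY of the fiber matrix of (1.83) equals (§3–§4, `g183`)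
  `δ_{μν}·A(l,l′;μ) + (Π_νY^G_ν/F^G)·B₁(l,μ)·B₂(l′,ν)`,
  `A(0,0;μ) = R^G_μ/Y^G_μ` (the `l′ = l` cancellation), `A(l,l′;μ) = δ_{ll′}/Δ(p′+l) − ū(p′+l)v̄_μ(p′+l)u(p′+l′)v_μ(p′+l′)·P(l,l′)/Y^G_μ`
  otherwise, `P(l,l′) = Δ(p′)/(Δ(p′+l)Δ(p′+l′))` resp. `1/Δ(p′+l′)` (`l = 0`) resp. `1/Δ(p′+l)` (`l′ = 0`);
  `B₁(l,μ) = b(l,μ)/Δ(p′)`: `= ū(p′+l)·(∂_μ(p′+l)Δ(p′)/(Δ²(p′+l)𝒩) − v̄_μ(p′+l)∂_{1,μ}/(Y^G_μΔ(p′+l)))` for `l ≠ 0`,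
  `= ū(p′)·(∂_μ(p′)R^G_μ − v̄_μ(p′)∂_{1,μ}Δ(p′)X_{≠0})/(𝒩·Y^G_μ)` for `l = 0` (the `l″ = l` cancellation);
  `B₂(l′,ν)` = the conjugate-leaf mirror of `B₁`,
whose only denominators are `Y^G_μ`, `Y^G_ν`, `F^G`, `𝒩` and the shifted `Δ(p′+l)`, `l ≠ 0` — all ZERO-FREE on a strip
of `d`-only width (§5).  The leaves are continued as ENTIRE functions: `ū ↦ B5Hk163Strip.uCbar`, `v̄_μ ↦ vCbar`,
`∂_μ(p′+l) ↦ dC`, `∂_{1,μ} ↦ B5Symbol166Strip.expFacPos`, and (new here) `u ↦ uC := Π_μ vC`, `v_μ ↦ B5Hk163Strip.vC`,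
`conj ∂_ν(p′+l′) ↦ dCbar`, `conj ∂_{1,ν} ↦ expFacNeg`; `|u|² ↦ B4Strip.U`, `|v_μ|² ↦ B4Strip.uFactor` (inside `Yc`, `Ncal`).

CONTENT.
* §1 the new entire leaves `uC`, `dCbar` and their values on the torus (`uC_ofReal = uSym`, `dCbar_ofReal = conj dSym`);
* §2 the `G`-denominators `RG`, `YG`, `EG`, `FG`, the factorisation `EG_eq_mul : E^G = Δ·F^G`, real forms;
* §3 the regrouped entry symbol `pairD`, `diagG`, `B1`, `B2`, `midG`, `g183`;
* §4 **identification** `g183_ofReal`: on the punctured Brillouin zone `s ∈ [−π,π]^d ∖ {0}`, for every `n ≥ 1`,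
  `μ, ν, l, l′`: `g183 n μ ν l l′ (s) = (B5Prop11Fiber.balabanFiber n _ 1 _ s _ _).G (l,μ) (l′,ν)` — the printed
  (1.83) fiber matrix (typed verbatim by this lineage as `B5Prop11Bound.Fiber.G`, `Fiber.φ` = (1.84)) IS the
  continued symbol at real momenta;
* §5 **the zero-free strip**: `kappa183 d = min(κ_N, κ_{YG}, κ_{FG})` (explicit, `d` only) with, on `Strip d κ`,
  `0 ≤ κ ≤ kappa183 d`, every `n ≥ 1`: `‖F^G‖ ≥ ((4/π²)^d)^d/2`, `‖Y^G_λ‖ ≥ (4/π²)^{d+1}/2`, `‖𝒩‖ ≥ (4/π²)^d/2`,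
  `‖Δ(p′+l)‖ ≥ 2` (`l ≠ 0`): `denominators_lower`, `denominators_ne_zero` (engine: real lower bound + Cauchy-estimate
  Im-Lipschitz lemma `B4StripCauchy.imLipschitz_of_fat` + `B4Strip.strip_lower_bound`, as in `B5Hk163Strip`);
* §6 **holomorphy**: `differentiableAt_g183` — every entry symbol is holomorphic (jointly on `ℂ^d`) at every point of
  the zero-free strip, for every `n`, `μ`, `ν` and EVERY pair of alias indices `l, l′`;
* §7 **the uniform bound**: `norm_g183_le` — on `Strip d κ`, `0 ≤ κ ≤ kappa183 d`, every `n ≥ 1`, `μ, ν, l, l′`: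
  `‖g183 n μ ν l l′ p‖ ≤ M183 d`, an explicit constant depending on `d` ONLY (leaf bounds `MD183`, `MB183`, `Mmid183`
  from the fat-region bounds of `B5Hk163Strip` §6 and the conjugation symmetry `‖vC(p)‖ = ‖vCbar(p̄)‖`);
* §8 **the package** `g183_strip_package`: `0 < kappa183 d` ∧ (holomorphy and the bound `M183 d` on every admissible
  strip) ∧ (the identification §4 at real momenta), bundled for the kernel / decay layer.

HONEST SCOPE.  (i) No kernel / decay statement is made here and no `StripRegular`-typed record is instantiated: what
IS proved is holomorphy (§6) and the uniform `d`-only bound `‖g183‖ ≤ M183 d` (§7) on the zero-free strip, bundled in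
§8; the Paley–Wiener / alias-summation step that turns this into decay of the kernel of `G` is the consumer's (cf.
`T4Hk163StripRate`).  (ii) `a = 1`, `U = 1`;
`n = L^k ≥ 1` arbitrary (`[NeZero n]`); general `a > 0` changes every denominator (`Y^G = Δ + aY`, …) and is not
treated.  (iii) The identification §4 is stated on the punctured real zone `s ≠ 0` where (1.83) is printed; `g183`
itself is defined and holomorphic through `p′ = 0` (the printed «extended by continuity to p′ = 0»); the printed
values AT `p′ = 0` (second and third equalities of (1.83)) are `B5Prop11Bound.opNorm_sandwich_G₀_le`'s fiber and are
not re-derived as limits here.  (iv) The decay in the alias indices `l, l′` and the `2π`-translation covariance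
(an alias re-indexing, as for (1.63)) are not addressed.
Value = kernel certificate (the analytic half of the analyticity method for (1.83), answering cell GAPS row
G-ne2p2-9 (β) for X9), NOT summit progress.  Unit `b2b-balaban-pv15-g10` (pv15 lineage = `B5Prop11Bound`/`Fiber`).
-/

noncomputable section

open scoped BigOperators ComplexConjugate
open Finset Complex

namespace Literature.MathematicalPhysics.QuantumFieldTheory.Balaban1983to89.B5G183Strip

open Literature.MathematicalPhysics.QuantumFieldTheory.Balaban1983to89.B4Strip
open Literature.MathematicalPhysics.QuantumFieldTheory.Balaban1983to89.B4StripCauchy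
open Literature.MathematicalPhysics.QuantumFieldTheory.Balaban1983to89.B5Prop11Leaves
open Literature.MathematicalPhysics.QuantumFieldTheory.Balaban1983to89.B5Prop11Fiber
open Literature.MathematicalPhysics.QuantumFieldTheory.Balaban1983to89.B5Prop11Bound
open Literature.MathematicalPhysics.QuantumFieldTheory.Balaban1983to89.B5Bounds167Lattice
open Literature.MathematicalPhysics.QuantumFieldTheory.Balaban1983to89.B5Symbol166
open Literature.MathematicalPhysics.QuantumFieldTheory.Balaban1983to89.B5Strip145
open Literature.MathematicalPhysics.QuantumFieldTheory.Balaban1983to89.B5Strip145Leaves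
open Literature.MathematicalPhysics.QuantumFieldTheory.Balaban1983to89.B5Strip145Analytic
open Literature.MathematicalPhysics.QuantumFieldTheory.Balaban1983to89.B5Symbol166Strip
open Literature.MathematicalPhysics.QuantumFieldTheory.Balaban1983to89.B5Hk163Strip

variable {d : ℕ}

/-! ## §1. The remaining entire leaves of (1.83): `u(p′+l′)` and `conj ∂_ν(p′+l′)` -/

/-- the holomorphic continuation of `u(p′+l) = Π_μ v_μ(p′+l)` (entire; `vC` = the geometric mean of
`B5Hk163Strip`). [cite: Balaban1984PropagatorsI, (1.31) p.23, (1.61) p.28 (text only)] [folklore] -/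
def uC (n : ℕ) (k : Fin d → Fin n) (p : Fin d → ℂ) : ℂ := ∏ μ, vC n k p μ

/-- the holomorphic continuation of `conj ∂_μ(p′+l) = η⁻¹(e^{−iη(p′_μ+l_μ)} − 1)` (entire). [folklore] -/
def dCbar (n : ℕ) (k : Fin d → Fin n) (p : Fin d → ℂ) (μ : Fin d) : ℂ :=
  (n : ℂ) * (Complex.exp (-(shift n k p μ / n * I)) - 1)

/-- on real momenta `uC = u(p′+l)` (`B5Prop11Fiber.uSym`). [folklore] -/
theorem uC_ofReal (n : ℕ) [NeZero n] (k : Fin d → Fin n) (s : Fin d → ℝ) :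
    uC n k (ofRealVec s) = uSym n k s := by
  unfold uC uSym
  exact Finset.prod_congr rfl (fun μ _ => vC_ofReal n k s μ)

/-- on real momenta `dCbar = conj ∂_μ(p′+l)` (`conj B5Prop11Fiber.dSym`). [folklore] -/
theorem dCbar_ofReal (n : ℕ) (k : Fin d → Fin n) (s : Fin d → ℝ) (μ : Fin d) :
    dCbar n k (ofRealVec s) μ = conj (dSym n k s μ) := by
  rw [← dC_ofReal n k s μ]
  unfold dCbar dC
  rw [map_mul, map_natCast, map_sub, map_one, ← Complex.exp_conj, shift_ofRealVec_apply]
  congr 3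
  simp only [map_mul, map_div₀, Complex.conj_ofReal, map_natCast, Complex.conj_I]
  ring

/-- on real momenta `X_{≠0}` is the real number `Xner`. [folklore] -/
theorem Xne_ofReal (n : ℕ) [NeZero n] (s : Fin d → ℝ) : Xne n (ofRealVec s) = ((Xner n s : ℝ) : ℂ) := by
  unfold Xne Xner
  simp only [U_ofReal, DeltaXi_ofReal, shift_ofReal]
  push_cast
  rfl


/-! ## §2. The `G`-denominators `Y^G_μ = Δ + Y_μ`, `R^G_μ = 1 + R̃_μ`, `F^G`, and `E^G = Δ·F^G` -/

section Defs

variable (n : ℕ) [NeZero n]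

/-- `R^G_λ(p′) := 1 + R̃_λ(p′)` (the `l ≠ 0` part of `φ_λ` of (1.84) plus its leading `1`, `a = 1`). [folklore] -/
def RG (lam : Fin d) (p : Fin d → ℂ) : ℂ := 1 + Rt n lam p

/-- `Y^G_λ(p′) := Δ(p′) + Y_λ(p′)` (`= Δ(p′)·φ_λ(p′)` with `φ_λ` of (1.84), `a = 1`, at real `p′ ≠ 0`). [folklore] -/
def YG (lam : Fin d) (p : Fin d → ℂ) : ℂ := DeltaXi n 0 p + Yc n lam p

/-- `E^G(p′) := Σ_λ S₁(p′_λ) Π_{λ′≠λ} Y^G_λ′(p′)` (`= Δ²(p′)·Σ_λ|∂_{1,λ}|²/φ_λ · ΠY^G/ΠΔφ …`, see `midG_ofReal`). [folklore] -/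
def EG (p : Fin d → ℂ) : ℂ := ∑ lam, S1 (p lam) * ∏ lam' ∈ univ.erase lam, YG n lam' p

/-- `F^G(p′) := U_0^d + Σ_λ S₁(p′_λ) Σ_{∅≠T⊆{λ′≠λ}} Δ^{|T|−1} Π_{λ′∈T} R^G_λ′ Π_{λ′∉T,λ′≠λ} c_λ′` — the denominator
with the factor `Δ(p′)` of `E^G` divided out EXACTLY (`EG_eq_mul`). [folklore] -/
def FG (p : Fin d → ℂ) : ℂ :=
  U n (fun _ => (0 : Fin n)) p ^ d
    + ∑ lam, S1 (p lam) * ∑ T ∈ ((univ.erase lam).powerset).erase ∅,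
        DeltaXi n 0 p ^ (T.card - 1)
          * ((∏ lam' ∈ T, RG n lam' p) * ∏ lam' ∈ (univ.erase lam) \ T, cfac n lam' p)

/-! ## §3. The regrouped entry symbol (every `Δ(p′)` cancelled; only zero-free denominators remain) -/

/-- the pair factor `P(l,l′)` of the second term: `Δ(p′)/(Δ(p′+l)Δ(p′+l′))` with the cancellations at `l = 0`
(`= 1/Δ(p′+l′)`) and at `l′ = 0` (`= 1/Δ(p′+l)`) performed symbolically (value at `l = l′ = 0` junk, unused). [folklore] -/
def pairD (k k' : Fin d → Fin n) (p : Fin d → ℂ) : ℂ :=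
  if k = fun _ => 0 then 1 / DeltaXi n 0 (shift n k' p)
  else if k' = fun _ => 0 then 1 / DeltaXi n 0 (shift n k p)
  else DeltaXi n 0 p / (DeltaXi n 0 (shift n k p) * DeltaXi n 0 (shift n k' p))

/-- the continued first-plus-second term of (1.83) (present only for `μ = ν`), `A(l,l′;μ)`:
at `l = l′ = 0` the `l′ = l` cancellation `1/Δ(p′) − |u(p′)v_μ(p′)|²/(Δ²(p′)φ_μ) = R^G_μ/Y^G_μ`; otherwise
`δ_{ll′}/Δ(p′+l) − ū(p′+l)v̄_μ(p′+l)·u(p′+l′)v_μ(p′+l′)·P(l,l′)/Y^G_μ`.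
[cite: Balaban1984PropagatorsI, (1.83) p.31, text after (1.87) p.32 (text only; regrouping ours)] [folklore] -/
def diagG (μ : Fin d) (k k' : Fin d → Fin n) (p : Fin d → ℂ) : ℂ :=
  if k = (fun _ => 0) ∧ k' = (fun _ => 0) then RG n μ p / YG n μ p
  else (if k = k' then 1 / DeltaXi n 0 (shift n k p) else 0)
    - uCbar n k p * vCbar n k p μ * (uC n k' p * vC n k' p μ) * pairD n k k' p / YG n μ p

/-- the continued FIRST square bracket of (1.83) divided by `Δ(p′)`, `B₁(l,μ) = b(l,μ)/Δ(p′)`: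
for `l ≠ 0`: `ū(p′+l)·(∂_μ(p′+l)·Δ(p′)/(Δ²(p′+l)𝒩) − v̄_μ(p′+l)·∂_{1,μ}/(Y^G_μ·Δ(p′+l)))`; for `l = 0` (the
`l″ = l` cancellation of (1.88)): `ū(p′)·(∂_μ(p′)·R^G_μ − v̄_μ(p′)·∂_{1,μ}·Δ(p′)·X_{≠0})/(𝒩·Y^G_μ)`.
[cite: Balaban1984PropagatorsI, (1.83) p.31, text after (1.88) p.32 (text only; regrouping ours)] [folklore] -/
def B1 (μ : Fin d) (k : Fin d → Fin n) (p : Fin d → ℂ) : ℂ :=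
  if k = fun _ => 0 then
    uCbar n k p * (dC n k p μ * RG n μ p - vCbar n k p μ * expFacPos μ p * DeltaXi n 0 p * Xne n p)
      / (Ncal n p * YG n μ p)
  else
    uCbar n k p * (dC n k p μ * DeltaXi n 0 p / (DeltaXi n 0 (shift n k p) ^ 2 * Ncal n p)
      - vCbar n k p μ * expFacPos μ p / (YG n μ p * DeltaXi n 0 (shift n k p)))

/-- the continued SECOND square bracket of (1.83) divided by `Δ(p′)`, `B₂(l′,ν) = conj b(l′,ν)/Δ(p′)` (the
conjugate-leaf mirror of `B1`: `u ↦ uC`, `v_ν ↦ vC`, `conj ∂_ν ↦ dCbar`, `conj ∂_{1,ν} ↦ expFacNeg`).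
[cite: Balaban1984PropagatorsI, (1.83) p.31 (text only; regrouping ours)] [folklore] -/
def B2 (ν : Fin d) (k' : Fin d → Fin n) (p : Fin d → ℂ) : ℂ :=
  if k' = fun _ => 0 then
    uC n k' p * (dCbar n k' p ν * RG n ν p - vC n k' p ν * expFacNeg ν p * DeltaXi n 0 p * Xne n p)
      / (Ncal n p * YG n ν p)
  else
    uC n k' p * (dCbar n k' p ν * DeltaXi n 0 p / (DeltaXi n 0 (shift n k' p) ^ 2 * Ncal n p)
      - vC n k' p ν * expFacNeg ν p / (YG n ν p * DeltaXi n 0 (shift n k' p)))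

/-- the continued scalar between the square brackets times `Δ²(p′)`:
`a⁻¹(Σ_λ|∂_{1,λ}(p′)|²/φ_λ(p′))⁻¹·Δ²(p′) = Π_νY^G_ν(p′)/F^G(p′)` («we get the additional factor Δ₀²(p′). This factor
multiplying the function between the square bracket expressions gives an inverse of the expression (1.86)»; here
with `Δ` in place of `Δ₀`, cf. `B5Hk163Strip`). [cite: Balaban1984PropagatorsI, (1.83) p.31, p.32 (text only)] [folklore] -/
def midG (p : Fin d → ℂ) : ℂ := (∏ lam, YG n lam p) / FG n p

/-- **THE CONTINUED (1.83) ENTRY SYMBOL**: `g_{μν}(l,l′;p′)` = the `((l,μ),(l′,ν))` entry of the fiber matrix of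
`G = Δ_1⁻¹` at COMPLEX `p′`, `= δ_{μν}·diagG + midG·B1(l,μ)·B2(l′,ν)`; its denominators are `Y^G_μ`, `Y^G_ν`, `F^G`,
`𝒩` and the shifted `Δ(p′+l)`, `l ≠ 0`, only (all zero-free on the strip of §5).
[cite: Balaban1984PropagatorsI, (1.83)–(1.84) p.31 (text of the formula only; regrouping ours)] [folklore] -/
def g183 (μ ν : Fin d) (k k' : Fin d → Fin n) (p : Fin d → ℂ) : ℂ :=
  (if μ = ν then diagG n μ k k' p else 0) + midG n p * B1 n μ k p * B2 n ν k' p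

end Defs

/-! ### §2 continued: the factorisation `E^G = Δ·F^G` and the real forms -/

/-- `Y^G_λ = c_λ + Δ·R^G_λ`. [folklore] -/
theorem YG_eq (n : ℕ) [NeZero n] (lam : Fin d) (p : Fin d → ℂ) :
    YG n lam p = cfac n lam p + DeltaXi n 0 p * RG n lam p := by
  unfold YG Yc RG; ring

/-- binomial expansion of `Π_{λ′≠λ} (c_λ′ + Δ R^G_λ′)` with the `T = ∅` term split off and one factor `Δ` extracted
from every other term. [folklore] -/
theorem prod_YG_expand (n : ℕ) [NeZero n] (p : Fin d → ℂ) (lam : Fin d) :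
    ∏ lam' ∈ univ.erase lam, YG n lam' p
      = ∏ lam' ∈ univ.erase lam, cfac n lam' p
        + DeltaXi n 0 p * ∑ T ∈ ((univ.erase lam).powerset).erase ∅,
            DeltaXi n 0 p ^ (T.card - 1)
              * ((∏ lam' ∈ T, RG n lam' p) * ∏ lam' ∈ (univ.erase lam) \ T, cfac n lam' p) := by
  have h1 : ∏ lam' ∈ univ.erase lam, YG n lam' p
      = ∏ lam' ∈ univ.erase lam, (DeltaXi n 0 p * RG n lam' p + cfac n lam' p) :=
    Finset.prod_congr rfl (fun lam' _ => by rw [YG_eq, add_comm])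
  rw [h1, Finset.prod_add, ← Finset.add_sum_erase _ _ (Finset.empty_mem_powerset (univ.erase lam))]
  simp only [Finset.prod_empty, Finset.sdiff_empty, one_mul]
  congr 1
  rw [Finset.mul_sum]
  refine Finset.sum_congr rfl (fun T hT => ?_)
  have hT : T ≠ ∅ := Finset.ne_of_mem_erase hT
  have hcard : T.card - 1 + 1 = T.card :=
    Nat.sub_add_cancel (Finset.card_pos.mpr (Finset.nonempty_of_ne_empty hT))
  rw [Finset.prod_mul_distrib, Finset.prod_const]
  conv_lhs => rw [← hcard, pow_succ]
  ring

/-- **THE FACTORISATION `E^G = Δ · F^G`** (an identity of functions on all of `ℂ^d`, every `n ≥ 1`). [folklore] -/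
theorem EG_eq_mul (n : ℕ) [NeZero n] (p : Fin d → ℂ) : EG n p = DeltaXi n 0 p * FG n p := by
  calc EG n p
      = ∑ lam, (S1 (p lam) * ∏ lam' ∈ univ.erase lam, cfac n lam' p
          + DeltaXi n 0 p * (S1 (p lam) * ∑ T ∈ ((univ.erase lam).powerset).erase ∅,
              DeltaXi n 0 p ^ (T.card - 1)
                * ((∏ lam' ∈ T, RG n lam' p) * ∏ lam' ∈ (univ.erase lam) \ T, cfac n lam' p))) := by
        unfold EG
        exact Finset.sum_congr rfl (fun lam _ => by rw [prod_YG_expand]; ring)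
    _ = U n (fun _ => (0 : Fin n)) p ^ d * DeltaXi n 0 p
          + DeltaXi n 0 p * ∑ lam, S1 (p lam) * ∑ T ∈ ((univ.erase lam).powerset).erase ∅,
              DeltaXi n 0 p ^ (T.card - 1)
                * ((∏ lam' ∈ T, RG n lam' p) * ∏ lam' ∈ (univ.erase lam) \ T, cfac n lam' p) := by
        rw [Finset.sum_add_distrib, sum_S1_prod_cfac, Finset.mul_sum]
    _ = DeltaXi n 0 p * FG n p := by unfold FG; ring

/-- `E^G = (Π_ν Y^G_ν)·Σ_ν S₁(p_ν)/Y^G_ν` wherever no `Y^G_ν` vanishes. [folklore] -/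
theorem EG_eq_prod_mul_sum (n : ℕ) [NeZero n] (p : Fin d → ℂ) (hY : ∀ ν, YG n ν p ≠ 0) :
    EG n p = (∏ ν, YG n ν p) * ∑ ν, S1 (p ν) / YG n ν p := by
  unfold EG
  rw [Finset.mul_sum]
  refine Finset.sum_congr rfl (fun ν _ => ?_)
  have hP : ∏ ν', YG n ν' p = YG n ν p * ∏ ν' ∈ univ.erase ν, YG n ν' p :=
    (Finset.mul_prod_erase _ _ (Finset.mem_univ ν)).symm
  rw [hP]
  field_simp [hY ν]

section RealForms

variable (n : ℕ) [NeZero n]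

/-- real form of `RG`. [folklore] -/
def RGr (lam : Fin d) (s : Fin d → ℝ) : ℝ := 1 + Rtr n lam s

/-- real form of `YG`: `Δ + (c_λ + Δ·R̃_λ)`. [folklore] -/
def YGr (lam : Fin d) (s : Fin d → ℝ) : ℝ := DeltaXir n 0 s + (cfacr n lam s + DeltaXir n 0 s * Rtr n lam s)

/-- real form of `FG`. [folklore] -/
def FGr (s : Fin d → ℝ) : ℝ :=
  Ur n (fun _ => (0 : Fin n)) s ^ d
    + ∑ lam, S1r (s lam) * ∑ T ∈ ((univ.erase lam).powerset).erase ∅,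
        DeltaXir n 0 s ^ (T.card - 1)
          * ((∏ lam' ∈ T, RGr n lam' s) * ∏ lam' ∈ (univ.erase lam) \ T, cfacr n lam' s)

end RealForms

/-- `RG` is real on real momenta. [folklore] -/
theorem RG_ofReal (n : ℕ) [NeZero n] (lam : Fin d) (s : Fin d → ℝ) :
    RG n lam (ofRealVec s) = ((RGr n lam s : ℝ) : ℂ) := by
  unfold RG RGr; rw [Rt_ofReal]; push_cast; ring

/-- `YG` is real on real momenta. [folklore] -/
theorem YG_ofReal (n : ℕ) [NeZero n] (lam : Fin d) (s : Fin d → ℝ) :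
    YG n lam (ofRealVec s) = ((YGr n lam s : ℝ) : ℂ) := by
  unfold YG YGr Yc; rw [cfac_ofReal, Rt_ofReal, DeltaXi_ofReal]; push_cast; ring

/-- `FG` is real on real momenta. [folklore] -/
theorem FG_ofReal (n : ℕ) [NeZero n] (s : Fin d → ℝ) :
    FG n (ofRealVec s) = ((FGr n s : ℝ) : ℂ) := by
  unfold FG FGr
  rw [U_ofReal, DeltaXi_ofReal]
  push_cast
  congr 1
  refine Finset.sum_congr rfl (fun lam _ => ?_)
  rw [S1_ofRealVec]
  congr 1
  refine Finset.sum_congr rfl (fun T _ => ?_)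
  rw [Finset.prod_congr rfl (fun lam' _ => RG_ofReal n lam' s),
    Finset.prod_congr rfl (fun lam' _ => cfac_ofReal n lam' s)]

/-- on the punctured zone `Y^G_λ = Δ·(1 + φ^{(1.62)}_λ) = Δ·φ^{(1.84)}_λ` (`a = 1`). [folklore] -/
theorem YGr_eq (n : ℕ) [NeZero n] (hn : 1 ≤ n) (lam : Fin d) (s : Fin d → ℝ)
    (hs : ∀ ν, |s ν| ≤ Real.pi) (ν₀ : Fin d) (hν₀ : s ν₀ ≠ 0) :
    YGr n lam s = DeltaXir n 0 s * (1 + phi162 n lam s) := by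
  unfold YGr; rw [cfacr_add_eq n hn lam s hs ν₀ hν₀]; ring

/-- `R^G_λ ≥ 1 > 0` on the reals. [folklore] -/
theorem RGr_pos (n : ℕ) [NeZero n] (lam : Fin d) (s : Fin d → ℝ) : 0 < RGr n lam s := by
  unfold RGr; linarith [Rtr_nonneg n lam s]

/-- `Y^G_λ ≥ c_λ ≥ (4/π²)^{d+1}` on the real Brillouin zone (Jordan). [folklore] -/
theorem YGr_ge (n : ℕ) [NeZero n] (hn : 1 ≤ n) (lam : Fin d) (s : Fin d → ℝ) (hs : ∀ μ, |s μ| ≤ Real.pi) :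
    (4 / Real.pi ^ 2) ^ (d + 1) ≤ YGr n lam s := by
  unfold YGr
  have h1 : (4 / Real.pi ^ 2) ^ (d + 1) ≤ cfacr n lam s := by
    unfold cfacr
    rw [pow_succ]
    exact mul_le_mul (Ur_zero_ge n hn s hs) (uFactorr_zero_ge n hn (s lam) (hs lam)) (by positivity)
      (Ur_nonneg _ _ _)
  have h2 : 0 ≤ DeltaXir n 0 s * Rtr n lam s :=
    mul_nonneg (DeltaXir_nonneg n 0 le_rfl s) (Rtr_nonneg n lam s)
  have h3 : 0 ≤ DeltaXir n 0 s := DeltaXir_nonneg n 0 le_rfl s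
  linarith

/-- `Y^G_λ > 0` on the real Brillouin zone. [folklore] -/
theorem YGr_pos (n : ℕ) [NeZero n] (hn : 1 ≤ n) (lam : Fin d) (s : Fin d → ℝ) (hs : ∀ μ, |s μ| ≤ Real.pi) :
    0 < YGr n lam s :=
  lt_of_lt_of_le (by positivity) (YGr_ge n hn lam s hs)

/-- `F^G ≥ U_0^d ≥ ((4/π²)^d)^d` on the real Brillouin zone (every other term is `≥ 0`). [folklore] -/
theorem FGr_lower (n : ℕ) [NeZero n] (hn : 1 ≤ n) (s : Fin d → ℝ) (hs : ∀ ν, |s ν| ≤ Real.pi) :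
    ((4 / Real.pi ^ 2) ^ d) ^ d ≤ FGr n s := by
  unfold FGr
  have h0 : 0 ≤ ∑ lam, S1r (s lam) * ∑ T ∈ ((univ.erase lam).powerset).erase ∅,
      DeltaXir n 0 s ^ (T.card - 1)
        * ((∏ lam' ∈ T, RGr n lam' s) * ∏ lam' ∈ (univ.erase lam) \ T, cfacr n lam' s) := by
    refine Finset.sum_nonneg fun lam _ => mul_nonneg (S1r_nonneg _) ?_
    refine Finset.sum_nonneg fun T _ => mul_nonneg (pow_nonneg (DeltaXir_nonneg _ 0 le_rfl _) _) ?_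
    exact mul_nonneg (Finset.prod_nonneg fun _ _ => (RGr_pos _ _ _).le)
      (Finset.prod_nonneg fun _ _ => cfacr_nonneg _ _ _)
  have h1 := Ur_zero_ge n hn s hs
  have h4 : 0 ≤ (4 / Real.pi ^ 2 : ℝ) ^ d := by positivity
  have h2 := pow_le_pow_left₀ h4 h1 d
  linarith

/-- `F^G > 0` on the real Brillouin zone. [folklore] -/
theorem FGr_pos (n : ℕ) [NeZero n] (hn : 1 ≤ n) (s : Fin d → ℝ) (hs : ∀ ν, |s ν| ≤ Real.pi) :
    0 < FGr n s :=
  lt_of_lt_of_le (by positivity) (FGr_lower n hn s hs)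


/-! ## §4. Identification with the printed (1.83) fiber matrix on real momenta

On the punctured Brillouin zone `p′ = s ∈ [−π,π]^d ∖ {0}` the fiber matrix `Fiber.G` of `B5Prop11Bound` (the display
(1.83) typed verbatim entry by entry, `Fiber.φ` = (1.84)) for Bałaban's functions (`B5Prop11Fiber.balabanFiber`,
`a = 1`: `u(p′+l) = uSym`, `v_μ = vSym`, `∂_μ = dSym`, `∂_{1,μ} = d1Sym`, `Δ(p′+l) = DeltaXir ∘ shiftr`) equals the
continued symbol `g183` at `ofRealVec s`.  All algebra is ours ([folklore]); the paper is cited for the TEXT only. -/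

section Ident

variable (n : ℕ) [NeZero n] (hn : 1 ≤ n) (s : Fin d → ℝ) (hs : ∀ μ, |s μ| ≤ Real.pi) (hs0 : s ≠ 0)

/-- the fiber has `a = 1`. [folklore] -/
theorem fib_a : (balabanFiber n hn 1 one_pos s hs hs0).a = 1 := rfl

/-- the fiber's `Δ(p′+l) = DeltaXir ∘ shiftr`. [folklore] -/
theorem fib_Δ (k : Fin d → Fin n) : (balabanFiber n hn 1 one_pos s hs hs0).Δ k = DeltaXir n 0 (shiftr n k s) := rfl

/-- the fiber's `u(p′+l) = uSym`. [folklore] -/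
theorem fib_u (k : Fin d → Fin n) : (balabanFiber n hn 1 one_pos s hs hs0).u k = uSym n k s := rfl

/-- the fiber's `v_μ(p′+l) = vSym`. [folklore] -/
theorem fib_v (μ : Fin d) (k : Fin d → Fin n) : (balabanFiber n hn 1 one_pos s hs hs0).v μ k = vSym n k s μ := rfl

/-- the fiber's `∂_μ(p′+l) = dSym`. [folklore] -/
theorem fib_e (μ : Fin d) (k : Fin d → Fin n) : (balabanFiber n hn 1 one_pos s hs hs0).e μ k = dSym n k s μ := rfl

/-- the fiber's `∂_{1,μ}(p′) = d1Sym`. [folklore] -/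
theorem fib_e₁ (μ : Fin d) : (balabanFiber n hn 1 one_pos s hs hs0).e₁ μ = d1Sym s μ := rfl

/-- (1.84) at `a = 1` on the torus leaves is `1 + φ^{(1.62)}` (`B5Bounds167Lattice.phi162`). [folklore] -/
theorem fib_φ (μ : Fin d) : (balabanFiber n hn 1 one_pos s hs hs0).φ μ = 1 + phi162 n μ s := by
  simp only [Fiber.φ, fib_a, fib_u, fib_v, fib_Δ, one_mul, phi162]
  congr 1
  refine Finset.sum_congr rfl (fun l _ => ?_)
  rw [norm_mul, mul_pow]

/-- `φ_μ = Y^G_μ/Δ` on the punctured zone. [folklore] -/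
theorem fib_φ_eq (μ : Fin d) :
    (balabanFiber n hn 1 one_pos s hs hs0).φ μ = YGr n μ s / DeltaXir n 0 s := by
  obtain ⟨ν₀, hν₀⟩ := Function.ne_iff.mp hs0
  have hD := DeltaXir_pos n hn s hs ν₀ hν₀
  rw [fib_φ, YGr_eq n hn μ s hs ν₀ hν₀]
  field_simp

/-- the printed `X = Σ_{l″}|u(p′+l″)|²/Δ²(p′+l″)` on the torus leaves. [folklore] -/
theorem fib_X : (balabanFiber n hn 1 one_pos s hs hs0).X
    = ∑ k : Fin d → Fin n, ‖uSym n k s‖ ^ 2 / DeltaXir n 0 (shiftr n k s) ^ 2 := by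
  simp only [Fiber.X, fib_u, fib_Δ]

/-- `𝒩 = Δ²·X` on the torus. [folklore] -/
theorem Ncal_ofReal_X :
    Ncal n (ofRealVec s) = ((DeltaXir n 0 s : ℝ) : ℂ) ^ 2 * (((balabanFiber n hn 1 one_pos s hs hs0).X : ℝ) : ℂ) := by
  obtain ⟨ν₀, hν₀⟩ := Function.ne_iff.mp hs0
  have hD : DeltaXi n 0 (ofRealVec s) = ((DeltaXir n 0 s : ℝ) : ℂ) := DeltaXi_ofReal n 0 s
  have hD0 : DeltaXi n 0 (ofRealVec s) ≠ 0 := by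
    rw [hD]; exact_mod_cast (DeltaXir_pos n hn s hs ν₀ hν₀).ne'
  rw [Ncal_eq_mul n _ hD0, hD, fib_X]
  push_cast
  congr 1
  refine Finset.sum_congr rfl (fun k _ => ?_)
  rw [U_ofReal_normSq n hn k s hs, DeltaXi_shift_ofReal n k s, Complex.normSq_eq_norm_sq]
  push_cast
  ring

/-- `X = 𝒩/Δ²` on the punctured zone. [folklore] -/
theorem fib_X_eq : (balabanFiber n hn 1 one_pos s hs hs0).X = Ncalr n s / DeltaXir n 0 s ^ 2 := by
  obtain ⟨ν₀, hν₀⟩ := Function.ne_iff.mp hs0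
  have hD := DeltaXir_pos n hn s hs ν₀ hν₀
  have h := Ncal_ofReal_X n hn s hs hs0
  rw [Ncal_ofReal] at h
  have h' : Ncalr n s = DeltaXir n 0 s ^ 2 * (balabanFiber n hn 1 one_pos s hs hs0).X := by exact_mod_cast h
  rw [h']
  field_simp

/-- the printed `Φ = Σ_λ|∂_{1,λ}|²/φ_λ` on the torus leaves. [folklore] -/
theorem fib_Φ : (balabanFiber n hn 1 one_pos s hs hs0).Φ = ∑ μ, S1r (s μ) / (1 + phi162 n μ s) := by
  simp only [Fiber.Φ, fib_e₁, fib_φ, norm_d1Sym_sq]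

/-- `Φ > 0` on the punctured zone. [folklore] -/
theorem fib_Φ_pos : 0 < (balabanFiber n hn 1 one_pos s hs hs0).Φ := by
  obtain ⟨ν₀, hν₀⟩ := Function.ne_iff.mp hs0
  have hφp : ∀ ν, 0 < 1 + phi162 n ν s := fun ν => by
    linarith [B5Action165Lagrange.phi162_pos n hn ν s hs ν₀ hν₀]
  rw [fib_Φ]
  have hterm : 0 < S1r (s ν₀) / (1 + phi162 n ν₀ s) := div_pos (S1r_pos_of_ne (hs ν₀) hν₀) (hφp ν₀)
  have hle : S1r (s ν₀) / (1 + phi162 n ν₀ s) ≤ ∑ ν, S1r (s ν) / (1 + phi162 n ν s) :=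
    Finset.single_le_sum (fun ν _ => div_nonneg (S1r_nonneg (s ν)) (hφp ν).le) (Finset.mem_univ ν₀)
  exact hterm.trans_le hle

include hn hs hs0 in
/-- `Y^G_μ = Δ·φ_μ` at real momenta, in complex form. [folklore] -/
theorem YG_ofReal_phi (μ : Fin d) :
    YG n μ (ofRealVec s) = ((DeltaXir n 0 s : ℝ) : ℂ) * (((1 + phi162 n μ s : ℝ)) : ℂ) := by
  obtain ⟨ν₀, hν₀⟩ := Function.ne_iff.mp hs0
  rw [YG_ofReal, YGr_eq n hn μ s hs ν₀ hν₀]; push_cast; ring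

/-- **the scalar between the brackets**: `Π_νY^G_ν/F^G = Δ²(p′)·a⁻¹Φ⁻¹` on the torus (`a = 1`). [folklore] -/
theorem midG_ofReal :
    midG n (ofRealVec s) = ((DeltaXir n 0 s : ℝ) : ℂ) ^ 2 / (((balabanFiber n hn 1 one_pos s hs hs0).Φ : ℝ) : ℂ) := by
  obtain ⟨ν₀, hν₀⟩ := Function.ne_iff.mp hs0
  have hDrp := DeltaXir_pos n hn s hs ν₀ hν₀
  have hDr : ((DeltaXir n 0 s : ℝ) : ℂ) ≠ 0 := by exact_mod_cast hDrp.ne'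
  have hφp : ∀ ν, 0 < 1 + phi162 n ν s := fun ν => by
    linarith [B5Action165Lagrange.phi162_pos n hn ν s hs ν₀ hν₀]
  have hφ : ∀ ν, ((1 + phi162 n ν s : ℝ) : ℂ) ≠ 0 := fun ν => by exact_mod_cast (hφp ν).ne'
  have hY : ∀ ν, YG n ν (ofRealVec s) = ((DeltaXir n 0 s : ℝ) : ℂ) * ((1 + phi162 n ν s : ℝ) : ℂ) :=
    fun ν => YG_ofReal_phi n hn s hs hs0 ν
  have hYne : ∀ ν, YG n ν (ofRealVec s) ≠ 0 := fun ν => by rw [hY ν]; exact mul_ne_zero hDr (hφ ν)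
  have hPY : (∏ ν, YG n ν (ofRealVec s)) ≠ 0 := Finset.prod_ne_zero_iff.mpr (fun ν _ => hYne ν)
  have hΦp := fib_Φ_pos n hn s hs hs0
  set Φ : ℝ := (balabanFiber n hn 1 one_pos s hs hs0).Φ with hΦdef
  have hΦ : ((Φ : ℝ) : ℂ) ≠ 0 := by exact_mod_cast hΦp.ne'
  have hsum : ∑ ν, S1 (ofRealVec s ν) / YG n ν (ofRealVec s) = ((Φ : ℝ) : ℂ) / ((DeltaXir n 0 s : ℝ) : ℂ) := by
    rw [hΦdef, fib_Φ]
    push_cast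
    rw [Finset.sum_div]
    refine Finset.sum_congr rfl (fun ν _ => ?_)
    rw [S1_ofRealVec, hY ν]
    have h1 : (1 : ℂ) + ((phi162 n ν s : ℝ) : ℂ) ≠ 0 := by exact_mod_cast (hφp ν).ne'
    push_cast
    field_simp
  have hE := EG_eq_mul n (ofRealVec s)
  rw [EG_eq_prod_mul_sum n _ hYne, hsum, DeltaXi_ofReal] at hE
  -- hE : ΠY · (Φ/Δ) = Δ · FG
  have hFG : FG n (ofRealVec s) = (∏ ν, YG n ν (ofRealVec s)) * ((Φ : ℝ) : ℂ) / ((DeltaXir n 0 s : ℝ) : ℂ) ^ 2 := by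
    have h2 : ((DeltaXir n 0 s : ℝ) : ℂ) ^ 2 * FG n (ofRealVec s)
        = (∏ ν, YG n ν (ofRealVec s)) * ((Φ : ℝ) : ℂ) := by
      have h3 : ((DeltaXir n 0 s : ℝ) : ℂ) * (((DeltaXir n 0 s : ℝ) : ℂ) * FG n (ofRealVec s))
          = ((DeltaXir n 0 s : ℝ) : ℂ) * ((∏ ν, YG n ν (ofRealVec s)) * (((Φ : ℝ) : ℂ) / ((DeltaXir n 0 s : ℝ) : ℂ))) := by
        rw [hE]
      rw [pow_two, mul_assoc, h3]
      field_simp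
    rw [← h2]
    field_simp
  unfold midG
  rw [hFG]
  field_simp

include hn hs in
/-- `conj z · z = |z|²` for the torus leaf `v_μ(p′)` at `l = 0`: `= uFactorr(0, p′_μ)`. [folklore] -/
theorem conj_vSym_mul_self (μ : Fin d) :
    conj (vSym n (fun _ => (0 : Fin n)) s μ) * vSym n (fun _ => (0 : Fin n)) s μ
      = ((uFactorr n 0 (s μ) : ℝ) : ℂ) := by
  rw [Complex.conj_mul', ← Complex.ofReal_pow, norm_vSym_sq n hn _ s μ (hs μ), Fin.val_zero]

include hn hs in
/-- `conj z · z = |z|²` for the torus leaf `u(p′)`: `= Ur(0, p′)`. [folklore] -/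
theorem conj_uSym_mul_self :
    conj (uSym n (fun _ => (0 : Fin n)) s) * uSym n (fun _ => (0 : Fin n)) s
      = ((Ur n (fun _ => (0 : Fin n)) s : ℝ) : ℂ) := by
  rw [Complex.conj_mul', ← Complex.ofReal_pow, norm_uSym_sq n hn _ s hs]

/-- **first + second term**: `diagG` on the torus is the `δ_{μν}`-part of the printed entry. [folklore] -/
theorem diagG_ofReal (μ : Fin d) (k k' : Fin d → Fin n) :
    diagG n μ k k' (ofRealVec s)
      = (if k = k' then 1 / (((balabanFiber n hn 1 one_pos s hs hs0).Δ k : ℝ) : ℂ) else 0)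
        - (((balabanFiber n hn 1 one_pos s hs hs0).a : ℝ) : ℂ)
            / (((balabanFiber n hn 1 one_pos s hs hs0).φ μ : ℝ) : ℂ)
          * (balabanFiber n hn 1 one_pos s hs hs0).x μ k
          * conj ((balabanFiber n hn 1 one_pos s hs hs0).x μ k') := by
  obtain ⟨ν₀, hν₀⟩ := Function.ne_iff.mp hs0
  have hDrp := DeltaXir_pos n hn s hs ν₀ hν₀
  have hDr : ((DeltaXir n 0 s : ℝ) : ℂ) ≠ 0 := by exact_mod_cast hDrp.ne'
  have hDk : ∀ l : Fin d → Fin n, ((DeltaXir n 0 (shiftr n l s) : ℝ) : ℂ) ≠ 0 := fun l => by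
    exact_mod_cast ((Delta1r_pos s hs ν₀ hν₀).trans_le (Delta1r_le_DeltaXir_shift n hn l s)).ne'
  have hYp := YGr_pos n hn μ s hs
  have hY : ((YGr n μ s : ℝ) : ℂ) ≠ 0 := by exact_mod_cast hYp.ne'
  simp only [Fiber.x, fib_a, fib_u, fib_v, fib_Δ, fib_φ_eq, map_mul, map_div₀, Complex.conj_conj,
    Complex.conj_ofReal]
  unfold diagG pairD
  by_cases hk : k = fun _ => 0
  · by_cases hk' : k' = fun _ => 0
    · -- the `l = l′ = 0` entry: the cancellation
      rw [if_pos ⟨hk, hk'⟩]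
      subst hk; subst hk'
      simp only [if_true]
      rw [RG_ofReal, YG_ofReal, shiftr_zero]
      -- the one relation among the atoms, solved for the numerator-only atom `R̃_μ`
      have hRexp : ((Rtr n μ s : ℝ) : ℂ)
          = (((YGr n μ s : ℝ) : ℂ) - ((DeltaXir n 0 s : ℝ) : ℂ)
              - conj (uSym n (fun _ => (0 : Fin n)) s) * uSym n (fun _ => (0 : Fin n)) s
                * (conj (vSym n (fun _ => (0 : Fin n)) s μ) * vSym n (fun _ => (0 : Fin n)) s μ))
            / ((DeltaXir n 0 s : ℝ) : ℂ) := by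
        rw [conj_uSym_mul_self n hn s hs, conj_vSym_mul_self n hn s hs μ]
        field_simp
        unfold YGr cfacr
        push_cast
        ring
      unfold RGr
      push_cast
      rw [hRexp]
      field_simp
      ring
    · rw [if_neg (fun h => hk' h.2), if_pos hk]
      have hkk : k ≠ k' := fun h => hk' (h ▸ hk)
      simp only [if_neg hkk]
      subst hk
      rw [uCbar_ofReal, vCbar_ofReal, uC_ofReal, vC_ofReal, YG_ofReal, DeltaXi_shift_ofReal n k' s,
        shiftr_zero]
      have := hDk k'
      push_cast
      field_simp
  · rw [if_neg (fun h => hk h.1), if_neg hk]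
    by_cases hk' : k' = fun _ => 0
    · rw [if_pos hk']
      have hkk : k ≠ k' := fun h => hk (h ▸ hk')
      simp only [if_neg hkk]
      subst hk'
      rw [uCbar_ofReal, vCbar_ofReal, uC_ofReal, vC_ofReal, YG_ofReal, DeltaXi_shift_ofReal n k s,
        shiftr_zero]
      have := hDk k
      push_cast
      field_simp
    · rw [if_neg hk']
      rw [uCbar_ofReal, vCbar_ofReal, uC_ofReal, vC_ofReal, YG_ofReal, DeltaXi_shift_ofReal n k s,
        DeltaXi_shift_ofReal n k' s, DeltaXi_ofReal]
      have := hDk k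
      have := hDk k'
      by_cases hkk : k = k'
      · subst hkk
        simp only [if_true]
        push_cast
        field_simp
      · simp only [if_neg hkk]
        push_cast
        field_simp

/-- **first square bracket**: `B1·Δ(p′) = b(l,μ)` on the torus (`Fiber.b`, including the `l″ = l` cancellation at
`l = 0`). [folklore] -/
theorem B1_ofReal (μ : Fin d) (k : Fin d → Fin n) :
    B1 n μ k (ofRealVec s) * ((DeltaXir n 0 s : ℝ) : ℂ) = (balabanFiber n hn 1 one_pos s hs hs0).b k μ := by
  obtain ⟨ν₀, hν₀⟩ := Function.ne_iff.mp hs0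
  have hDrp := DeltaXir_pos n hn s hs ν₀ hν₀
  have hDr : ((DeltaXir n 0 s : ℝ) : ℂ) ≠ 0 := by exact_mod_cast hDrp.ne'
  have hDk : ∀ l : Fin d → Fin n, ((DeltaXir n 0 (shiftr n l s) : ℝ) : ℂ) ≠ 0 := fun l => by
    exact_mod_cast ((Delta1r_pos s hs ν₀ hν₀).trans_le (Delta1r_le_DeltaXir_shift n hn l s)).ne'
  have hYp := YGr_pos n hn μ s hs
  have hY : ((YGr n μ s : ℝ) : ℂ) ≠ 0 := by exact_mod_cast hYp.ne'
  have hNp : 0 < Ncalr n s := lt_of_lt_of_le (by positivity) (Ncalr_ge n hn s hs)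
  have hN : ((Ncalr n s : ℝ) : ℂ) ≠ 0 := by exact_mod_cast hNp.ne'
  simp only [Fiber.b, fib_a, fib_u, fib_v, fib_e, fib_e₁, fib_Δ, fib_φ_eq, fib_X_eq, map_mul]
  unfold B1
  by_cases hk : k = fun _ => 0
  · rw [if_pos hk]
    subst hk
    rw [uCbar_ofReal, dC_ofReal, vCbar_ofReal, expFacPos_ofReal, RG_ofReal, Xne_ofReal, Ncal_ofReal, YG_ofReal,
      DeltaXi_ofReal, shiftr_zero, d1Sym_eq_vSym_mul n hn (fun _ => (0 : Fin n)) s μ]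
    -- the one relation among the atoms `Y^G_μ, 𝒩, Δ, R̃_μ, X_{≠0}, v̄_μ v_μ`, solved for `R̃_μ`
    have hRexp : ((Rtr n μ s : ℝ) : ℂ)
        = (((YGr n μ s : ℝ) : ℂ) - ((DeltaXir n 0 s : ℝ) : ℂ)
            - (((Ncalr n s : ℝ) : ℂ) - ((DeltaXir n 0 s : ℝ) : ℂ) ^ 2 * ((Xner n s : ℝ) : ℂ))
              * (conj (vSym n (fun _ => (0 : Fin n)) s μ) * vSym n (fun _ => (0 : Fin n)) s μ))
          / ((DeltaXir n 0 s : ℝ) : ℂ) := by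
      rw [conj_vSym_mul_self n hn s hs μ]
      field_simp
      unfold YGr cfacr Ncalr
      push_cast
      ring
    unfold RGr
    push_cast
    rw [hRexp]
    field_simp
    ring
  · rw [if_neg hk]
    rw [uCbar_ofReal, dC_ofReal, vCbar_ofReal, expFacPos_ofReal, Ncal_ofReal, YG_ofReal, DeltaXi_ofReal,
      DeltaXi_shift_ofReal n k s]
    have := hDk k
    push_cast
    field_simp

/-- **second square bracket**: `B2·Δ(p′) = conj b(l′,ν)` on the torus. [folklore] -/
theorem B2_ofReal (ν : Fin d) (k' : Fin d → Fin n) :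
    B2 n ν k' (ofRealVec s) * ((DeltaXir n 0 s : ℝ) : ℂ) = conj ((balabanFiber n hn 1 one_pos s hs hs0).b k' ν) := by
  obtain ⟨ν₀, hν₀⟩ := Function.ne_iff.mp hs0
  have hDrp := DeltaXir_pos n hn s hs ν₀ hν₀
  have hDr : ((DeltaXir n 0 s : ℝ) : ℂ) ≠ 0 := by exact_mod_cast hDrp.ne'
  have hDk : ∀ l : Fin d → Fin n, ((DeltaXir n 0 (shiftr n l s) : ℝ) : ℂ) ≠ 0 := fun l => by
    exact_mod_cast ((Delta1r_pos s hs ν₀ hν₀).trans_le (Delta1r_le_DeltaXir_shift n hn l s)).ne'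
  have hYp := YGr_pos n hn ν s hs
  have hY : ((YGr n ν s : ℝ) : ℂ) ≠ 0 := by exact_mod_cast hYp.ne'
  have hNp : 0 < Ncalr n s := lt_of_lt_of_le (by positivity) (Ncalr_ge n hn s hs)
  have hN : ((Ncalr n s : ℝ) : ℂ) ≠ 0 := by exact_mod_cast hNp.ne'
  simp only [Fiber.b, fib_a, fib_u, fib_v, fib_e, fib_e₁, fib_Δ, fib_φ_eq, fib_X_eq, map_mul, map_sub,
    map_div₀, map_pow, Complex.conj_conj, Complex.conj_ofReal]
  unfold B2
  by_cases hk : k' = fun _ => 0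
  · rw [if_pos hk]
    subst hk
    rw [uC_ofReal, dCbar_ofReal, vC_ofReal, expFacNeg_ofReal, RG_ofReal, Xne_ofReal, Ncal_ofReal, YG_ofReal,
      DeltaXi_ofReal, shiftr_zero, d1Sym_eq_vSym_mul n hn (fun _ => (0 : Fin n)) s ν]
    simp only [map_mul]
    have hRexp : ((Rtr n ν s : ℝ) : ℂ)
        = (((YGr n ν s : ℝ) : ℂ) - ((DeltaXir n 0 s : ℝ) : ℂ)
            - (((Ncalr n s : ℝ) : ℂ) - ((DeltaXir n 0 s : ℝ) : ℂ) ^ 2 * ((Xner n s : ℝ) : ℂ))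
              * (conj (vSym n (fun _ => (0 : Fin n)) s ν) * vSym n (fun _ => (0 : Fin n)) s ν))
          / ((DeltaXir n 0 s : ℝ) : ℂ) := by
      rw [conj_vSym_mul_self n hn s hs ν]
      field_simp
      unfold YGr cfacr Ncalr
      push_cast
      ring
    unfold RGr
    push_cast
    rw [hRexp]
    field_simp
    ring
  · rw [if_neg hk]
    rw [uC_ofReal, dCbar_ofReal, vC_ofReal, expFacNeg_ofReal, Ncal_ofReal, YG_ofReal, DeltaXi_ofReal,
      DeltaXi_shift_ofReal n k' s]
    have := hDk k'
    push_cast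
    field_simp

/-- **third term**: `midG·B1·B2 = a⁻¹Φ⁻¹·b(l,μ)·conj b(l′,ν)` on the torus. [folklore] -/
theorem third_ofReal (μ ν : Fin d) (k k' : Fin d → Fin n) :
    midG n (ofRealVec s) * B1 n μ k (ofRealVec s) * B2 n ν k' (ofRealVec s)
      = (balabanFiber n hn 1 one_pos s hs hs0).cT * (balabanFiber n hn 1 one_pos s hs hs0).b k μ
          * conj ((balabanFiber n hn 1 one_pos s hs hs0).b k' ν) := by
  obtain ⟨ν₀, hν₀⟩ := Function.ne_iff.mp hs0
  have hDrp := DeltaXir_pos n hn s hs ν₀ hν₀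
  have hDr : ((DeltaXir n 0 s : ℝ) : ℂ) ≠ 0 := by exact_mod_cast hDrp.ne'
  have hΦ : ((((balabanFiber n hn 1 one_pos s hs hs0).Φ : ℝ)) : ℂ) ≠ 0 := by
    exact_mod_cast (fib_Φ_pos n hn s hs hs0).ne'
  rw [← B1_ofReal n hn s hs hs0 μ k, ← B2_ofReal n hn s hs hs0 ν k', midG_ofReal n hn s hs hs0, Fiber.cT, fib_a]
  push_cast
  field_simp

/-- **(1.83) ON THE TORUS = THE CONTINUED ENTRY SYMBOL AT REAL MOMENTA.**  For `n ≥ 1`, `s ∈ [−π,π]^d ∖ {0}`,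
all `μ, ν` and all alias indices `l, l′`: the `((l,μ),(l′,ν))` entry of the printed fiber matrix (1.83) of `G = Δ_1⁻¹`
(`B5Prop11Bound.Fiber.G` on `B5Prop11Fiber.balabanFiber`, `a = 1`) equals `g183 n μ ν l l′ (s)`.
[cite: Balaban1984PropagatorsI, (1.83)–(1.84) p.31 (text of the formula only; the identity is ours)] [folklore] -/
theorem g183_ofReal (μ ν : Fin d) (k k' : Fin d → Fin n) :
    g183 n μ ν k k' (ofRealVec s) = (balabanFiber n hn 1 one_pos s hs hs0).G (k, μ) (k', ν) := by
  unfold g183 Fiber.G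
  dsimp only
  rw [diagG_ofReal n hn s hs hs0 μ k k', third_ofReal n hn s hs hs0 μ ν k k']

end Ident


/-! ## §5. The zero-free strip `|Im p′_ν| ≤ κ₁₈₃(d)` — `d`-only, uniform in `n ≥ 1` and in the alias indices

Every denominator of `g183` is bounded away from zero on `Strip d κ`, `0 ≤ κ ≤ κ₁₈₃(d)`:
`‖F^G‖ ≥ ((4/π²)^d)^d/2`, `‖Y^G_λ‖ ≥ (4/π²)^{d+1}/2` (new, the b05 engine: real lower bound + Cauchy-estimate
Im-Lipschitz bound `B4StripCauchy.imLipschitz_of_fat` + `B4Strip.strip_lower_bound`), `‖𝒩‖ ≥ (4/π²)^d/2`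
(`B5Hk163Strip.Ncal_lower`, by name), `‖Δ(p′+l)‖ ≥ 2` for `l ≠ 0` (`B4StripCauchy.norm_DeltaXi_shift_ge`, by name). -/

section Strip

/-- `‖R^G_λ‖ ≤ 2B` on `F_r`. [folklore] -/
theorem norm_RG_le (n : ℕ) [NeZero n] {r : ℝ} (hr : r ≤ 1 / 4) (hdr : (d : ℝ) * r ^ 2 ≤ 1 / 16)
    {q : Fin d → ℂ} (hq : q ∈ Fat d r) (lam : Fin d) : ‖RG n lam q‖ ≤ 2 * Bc d := by
  unfold RG
  have h1 := norm_Rt_le_Bc n hr hdr hq lam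
  have hB := one_le_Bc d
  calc ‖1 + Rt n lam q‖ ≤ ‖(1 : ℂ)‖ + ‖Rt n lam q‖ := norm_add_le _ _
    _ ≤ 1 + Bc d := by rw [norm_one]; linarith
    _ ≤ 2 * Bc d := by linarith

/-- `‖Y^G_λ‖ ≤ 3B²` on `F_r`. [folklore] -/
theorem norm_YG_le (n : ℕ) [NeZero n] {r : ℝ} (hr : r ≤ 1 / 4) (hdr : (d : ℝ) * r ^ 2 ≤ 1 / 16)
    {q : Fin d → ℂ} (hq : q ∈ Fat d r) (lam : Fin d) : ‖YG n lam q‖ ≤ 3 * Bc d ^ 2 := by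
  unfold YG
  have h1 := norm_Yc_le n hr hdr hq lam
  have h2 := norm_DeltaXi0_le_Bc n hr hq
  have hB := one_le_Bc d
  calc ‖DeltaXi n 0 q + Yc n lam q‖ ≤ ‖DeltaXi n 0 q‖ + ‖Yc n lam q‖ := norm_add_le _ _
    _ ≤ Bc d + 2 * Bc d ^ 2 := add_le_add h2 h1
    _ ≤ 3 * Bc d ^ 2 := by nlinarith

/-- `R^G` is jointly holomorphic on `F_r`. [folklore] -/
theorem differentiableAt_RG (n : ℕ) [NeZero n] {r : ℝ} (hr : r ≤ 1 / 4) (hdr : (d : ℝ) * r ^ 2 ≤ 1 / 16)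
    {q : Fin d → ℂ} (hq : q ∈ Fat d r) (lam : Fin d) :
    DifferentiableAt ℂ (fun p : Fin d → ℂ => RG n lam p) q := by
  unfold RG
  exact (differentiableAt_Rt n hr hdr hq lam).const_add _

/-- `Y^G` is jointly holomorphic on `F_r`. [folklore] -/
theorem differentiableAt_YG (n : ℕ) [NeZero n] {r : ℝ} (hr : r ≤ 1 / 4) (hdr : (d : ℝ) * r ^ 2 ≤ 1 / 16)
    {q : Fin d → ℂ} (hq : q ∈ Fat d r) (lam : Fin d) :
    DifferentiableAt ℂ (fun p : Fin d → ℂ => YG n lam p) q := by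
  unfold YG
  exact (differentiableAt_DeltaXi n 0 q).add (differentiableAt_Yc n hr hdr hq lam)

/-- `F^G` is jointly holomorphic on `F_r`. [folklore] -/
theorem differentiableAt_FG (n : ℕ) [NeZero n] {r : ℝ} (hr : r ≤ 1 / 4) (hdr : (d : ℝ) * r ^ 2 ≤ 1 / 16)
    {q : Fin d → ℂ} (hq : q ∈ Fat d r) : DifferentiableAt ℂ (fun p : Fin d → ℂ => FG n p) q := by
  unfold FG
  refine ((differentiableAt_U n hr hq _).pow d).add ?_
  refine DifferentiableAt.fun_sum (fun lam _ => ?_)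
  refine ((differentiable_S1 _).comp q (differentiableAt_apply (𝕜 := ℂ) lam q)).mul ?_
  refine DifferentiableAt.fun_sum (fun T _ => ?_)
  refine ((differentiableAt_DeltaXi n 0 q).pow _).mul ?_
  exact (dAt_finset_prod T _ q (fun lam' _ => differentiableAt_RG n hr hdr hq lam')).mul
    (dAt_finset_prod _ _ q (fun lam' _ => differentiableAt_cfac n hr hq lam'))

/-- `X_{≠0}` is jointly holomorphic on `F_r` (shifted denominators do not vanish there). [folklore] -/
theorem differentiableAt_Xne (n : ℕ) [NeZero n] {r : ℝ} (hr : r ≤ 1 / 4) (hdr : (d : ℝ) * r ^ 2 ≤ 1 / 16)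
    {q : Fin d → ℂ} (hq : q ∈ Fat d r) : DifferentiableAt ℂ (fun p : Fin d → ℂ => Xne n p) q := by
  unfold Xne
  refine DifferentiableAt.fun_sum (fun k hk => ?_)
  have hk0 : k ≠ fun _ => 0 := Finset.ne_of_mem_erase hk
  have hΔ : DeltaXi n 0 (shift n k q) ≠ 0 := by
    intro h
    have := norm_DeltaXi_shift_ge n 0 le_rfl hr hdr hq k hk0
    rw [h, norm_zero] at this
    linarith
  exact dAt_div (differentiableAt_U n hr hq k) ((differentiableAt_DeltaXi_shift n 0 k q).pow 2)
    (pow_ne_zero 2 hΔ)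

/-- on real momenta `‖Y^G_λ‖ ≥ (4/π²)^{d+1}`. [folklore] -/
theorem norm_YG_real_ge (n : ℕ) [NeZero n] (lam : Fin d) (s : Fin d → ℝ) (hs : ∀ μ, |s μ| ≤ Real.pi) :
    (4 / Real.pi ^ 2) ^ (d + 1) ≤ ‖YG n lam (ofRealVec s)‖ := by
  have hn : 1 ≤ n := Nat.one_le_iff_ne_zero.mpr (NeZero.ne n)
  rw [YG_ofReal, Complex.norm_real, Real.norm_eq_abs]
  exact (YGr_ge n hn lam s hs).trans (le_abs_self _)

/-- the `Y^G`-strip half-width `κ_{YG}(d) = min(r, c·r/(3B²(d+1)))`, `c = (4/π²)^{d+1}/2`, `r = rOf d`, `B = Bc d`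
(depends on `d` only). [folklore] -/
def kappaYG (d : ℕ) : ℝ :=
  min (rOf d) ((4 / Real.pi ^ 2) ^ (d + 1) / 2 * rOf d / (3 * Bc d ^ 2 * ((d : ℝ) + 1)))

/-- `0 < κ_{YG}(d)`. [folklore] -/
theorem kappaYG_pos (d : ℕ) : 0 < kappaYG d := by
  unfold kappaYG
  have h1 := rOf_pos d
  have h2 := Bc_pos d
  have h3 : (0 : ℝ) < (4 / Real.pi ^ 2) ^ (d + 1) / 2 := by positivity
  exact lt_min h1 (by positivity)

/-- `κ_{YG}(d) ≤ r`. [folklore] -/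
theorem kappaYG_le_rOf (d : ℕ) : kappaYG d ≤ rOf d := min_le_left _ _

/-- **`Y^G_λ` IS ZERO-FREE ON THE STRIP**: `‖Y^G_λ(p)‖ ≥ (4/π²)^{d+1}/2` on `Strip d κ`, `0 ≤ κ ≤ κ_{YG}(d)`, every
`n ≥ 1`, every direction `λ`. [folklore] -/
theorem YG_lower (n : ℕ) [NeZero n] {κ : ℝ} (hκ0 : 0 ≤ κ) (hκ : κ ≤ kappaYG d) (lam : Fin d) :
    ∀ p ∈ Strip d κ, (4 / Real.pi ^ 2) ^ (d + 1) / 2 ≤ ‖YG n lam p‖ := by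
  have hr := rOf_pos d
  have hκr : κ ≤ rOf d := hκ.trans (kappaYG_le_rOf d)
  have hB := Bc_pos d
  set c : ℝ := (4 / Real.pi ^ 2) ^ (d + 1) / 2 with hc
  have hc0 : 0 < c := by positivity
  have hdiff : ∀ q ∈ Fat d (rOf d), ∀ μ,
      DifferentiableAt ℂ (fun w => YG n lam (Function.update q μ w)) (q μ) := by
    intro q hq μ
    have h := differentiableAt_YG n (rOf_le d) (d_mul_rOf_sq_le d) hq lam
    rw [← Function.update_eq_self μ q] at h
    exact h.comp (q μ) (differentiableAt_update q μ (q μ))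
  have hlip := imLipschitz_of_fat (fun p => YG n lam p) hr hκ0 hκr hdiff
    (fun q hq => norm_YG_le n (rOf_le d) (d_mul_rOf_sq_le d) hq lam)
  refine strip_lower_bound (fun p => YG n lam p) c (3 * Bc d ^ 2 / rOf d) κ ?_ hlip (by positivity) ?_
  · intro s hs
    rw [hc]
    have := norm_YG_real_ge n lam s hs
    linarith
  · have hκ2 : κ ≤ c * rOf d / (3 * Bc d ^ 2 * ((d : ℝ) + 1)) := hκ.trans (min_le_right _ _)
    have hd : (0 : ℝ) ≤ d := Nat.cast_nonneg d
    calc 3 * Bc d ^ 2 / rOf d * (d * κ)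
        ≤ 3 * Bc d ^ 2 / rOf d * (d * (c * rOf d / (3 * Bc d ^ 2 * ((d : ℝ) + 1)))) := by gcongr
      _ = c * (d / ((d : ℝ) + 1)) := by field_simp
      _ ≤ c * 1 := by
          gcongr
          rw [div_le_one (by positivity)]
          linarith
      _ = c := mul_one c

/-- on real momenta `‖F^G‖ ≥ ((4/π²)^d)^d`. [folklore] -/
theorem norm_FG_real_ge (n : ℕ) [NeZero n] (s : Fin d → ℝ) (hs : ∀ μ, |s μ| ≤ Real.pi) :
    ((4 / Real.pi ^ 2) ^ d) ^ d ≤ ‖FG n (ofRealVec s)‖ := by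
  have hn : 1 ≤ n := Nat.one_le_iff_ne_zero.mpr (NeZero.ne n)
  rw [FG_ofReal, Complex.norm_real, Real.norm_eq_abs]
  exact (FGr_lower n hn s hs).trans (le_abs_self _)

/-- the explicit fat-region bound of `F^G` (the bound `MF` of `B5Symbol166Strip` with `B ↦ 2B`). [folklore] -/
def MFG (d : ℕ) : ℝ := (2 * Bc d) ^ d + d * ((2 * Bc d) * (2 ^ d * ((2 * Bc d) ^ d) ^ 3))

/-- `0 < MFG d`. [folklore] -/
theorem MFG_pos (d : ℕ) : 0 < MFG d := by
  unfold MFG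
  have hB := Bc_pos d
  positivity

/-- `‖F^G‖ ≤ MFG d` on `F_r`. [folklore] -/
theorem norm_FG_le (n : ℕ) [NeZero n] {r : ℝ} (hr : r ≤ 1 / 4) (hdr : (d : ℝ) * r ^ 2 ≤ 1 / 16)
    {q : Fin d → ℂ} (hq : q ∈ Fat d r) : ‖FG n q‖ ≤ MFG d := by
  have hB1 := one_le_Bc d
  have hB : (1 : ℝ) ≤ 2 * Bc d := by linarith
  have hB0 : (0 : ℝ) < 2 * Bc d := by linarith
  have hBd : 1 ≤ (2 * Bc d) ^ d := one_le_pow₀ hB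
  have hRG : ∀ lam, ‖RG n lam q‖ ≤ 2 * Bc d := fun lam => norm_RG_le n hr hdr hq lam
  have hcf : ∀ lam, ‖cfac n lam q‖ ≤ 2 * Bc d := fun lam => (norm_cfac_le_Bc n hr hq lam).trans (by linarith)
  have hΔ : ‖DeltaXi n 0 q‖ ≤ 2 * Bc d := (norm_DeltaXi0_le_Bc n hr hq).trans (by linarith)
  have hS : ∀ lam, ‖S1 (q lam)‖ ≤ 2 * Bc d := fun lam => (norm_S1_le_Bc hr hq lam).trans (by linarith)
  -- the `U_0^d` term
  have hU : ‖U n (fun _ => (0 : Fin n)) q ^ d‖ ≤ (2 * Bc d) ^ d := by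
    rw [norm_pow]
    refine pow_le_pow_left₀ (norm_nonneg _) ((norm_U_zero_le n hr hq).trans ?_) d
    have : (4 : ℝ) ^ d ≤ 4 ^ (d + 1) := pow_le_pow_right₀ (by norm_num) (Nat.le_succ d)
    unfold Bc
    have h1 : (0 : ℝ) ≤ 16 * d := by positivity
    have h3 : (0 : ℝ) ≤ 66 * 132 ^ d := by positivity
    have h4 : (0 : ℝ) ≤ 4 ^ (d + 1) := by positivity
    linarith
  -- each `T`-summand
  have hT : ∀ lam : Fin d, ∀ T ∈ ((univ.erase lam).powerset).erase ∅,
      ‖DeltaXi n 0 q ^ (T.card - 1)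
          * ((∏ lam' ∈ T, RG n lam' q) * ∏ lam' ∈ (univ.erase lam) \ T, cfac n lam' q)‖ ≤ ((2 * Bc d) ^ d) ^ 3 := by
    intro lam T hT
    have hcardT : T.card ≤ d := (Finset.card_le_univ T).trans (by simp)
    have hcardS : ((univ.erase lam) \ T).card ≤ d := (Finset.card_le_univ _).trans (by simp)
    have e1 : ‖DeltaXi n 0 q ^ (T.card - 1)‖ ≤ (2 * Bc d) ^ d := by
      rw [norm_pow]
      calc ‖DeltaXi n 0 q‖ ^ (T.card - 1) ≤ (2 * Bc d) ^ (T.card - 1) :=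
            pow_le_pow_left₀ (norm_nonneg _) hΔ _
        _ ≤ (2 * Bc d) ^ d := pow_le_pow_right₀ hB (by omega)
    have e2 : ‖∏ lam' ∈ T, RG n lam' q‖ ≤ (2 * Bc d) ^ d :=
      norm_prod_le_pow T _ hB hcardT (fun lam' _ => hRG lam')
    have e3 : ‖∏ lam' ∈ (univ.erase lam) \ T, cfac n lam' q‖ ≤ (2 * Bc d) ^ d :=
      norm_prod_le_pow _ _ hB hcardS (fun lam' _ => hcf lam')
    rw [norm_mul, norm_mul]
    calc ‖DeltaXi n 0 q ^ (T.card - 1)‖ * (‖∏ lam' ∈ T, RG n lam' q‖ * ‖∏ lam' ∈ (univ.erase lam) \ T, cfac n lam' q‖)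
        ≤ (2 * Bc d) ^ d * ((2 * Bc d) ^ d * (2 * Bc d) ^ d) := by gcongr
      _ = ((2 * Bc d) ^ d) ^ 3 := by ring
  -- the number of `T`'s
  have hcard : ∀ lam : Fin d, ((((univ.erase lam).powerset).erase ∅).card : ℝ) ≤ 2 ^ d := by
    intro lam
    have h1 : (((univ.erase lam).powerset).erase ∅).card ≤ ((univ.erase lam).powerset).card :=
      Finset.card_erase_le
    rw [Finset.card_powerset] at h1
    have h2 : 2 ^ (univ.erase lam).card ≤ 2 ^ d :=
      Nat.pow_le_pow_right (by norm_num) ((Finset.card_le_univ _).trans (by simp))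
    exact_mod_cast h1.trans h2
  have hinner : ∀ lam : Fin d,
      ‖S1 (q lam) * ∑ T ∈ ((univ.erase lam).powerset).erase ∅, DeltaXi n 0 q ^ (T.card - 1)
          * ((∏ lam' ∈ T, RG n lam' q) * ∏ lam' ∈ (univ.erase lam) \ T, cfac n lam' q)‖
        ≤ (2 * Bc d) * (2 ^ d * ((2 * Bc d) ^ d) ^ 3) := by
    intro lam
    rw [norm_mul]
    refine mul_le_mul (hS lam) ?_ (norm_nonneg _) hB0.le
    calc ‖∑ T ∈ ((univ.erase lam).powerset).erase ∅, DeltaXi n 0 q ^ (T.card - 1)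
            * ((∏ lam' ∈ T, RG n lam' q) * ∏ lam' ∈ (univ.erase lam) \ T, cfac n lam' q)‖
        ≤ ∑ T ∈ ((univ.erase lam).powerset).erase ∅, ‖DeltaXi n 0 q ^ (T.card - 1)
            * ((∏ lam' ∈ T, RG n lam' q) * ∏ lam' ∈ (univ.erase lam) \ T, cfac n lam' q)‖ := norm_sum_le _ _
      _ ≤ ∑ _T ∈ ((univ.erase lam).powerset).erase ∅, ((2 * Bc d) ^ d) ^ 3 := Finset.sum_le_sum (hT lam)
      _ = (((univ.erase lam).powerset).erase ∅).card * ((2 * Bc d) ^ d) ^ 3 := by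
          rw [Finset.sum_const, nsmul_eq_mul]
      _ ≤ 2 ^ d * ((2 * Bc d) ^ d) ^ 3 := by
          have := hcard lam
          have h3 : (0 : ℝ) ≤ ((2 * Bc d) ^ d) ^ 3 := by positivity
          nlinarith
  unfold FG
  calc ‖U n (fun _ => (0 : Fin n)) q ^ d + ∑ lam, S1 (q lam) * ∑ T ∈ ((univ.erase lam).powerset).erase ∅,
          DeltaXi n 0 q ^ (T.card - 1) * ((∏ lam' ∈ T, RG n lam' q) * ∏ lam' ∈ (univ.erase lam) \ T, cfac n lam' q)‖
      ≤ ‖U n (fun _ => (0 : Fin n)) q ^ d‖ + ∑ lam, ‖S1 (q lam) * ∑ T ∈ ((univ.erase lam).powerset).erase ∅,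
          DeltaXi n 0 q ^ (T.card - 1) * ((∏ lam' ∈ T, RG n lam' q) * ∏ lam' ∈ (univ.erase lam) \ T, cfac n lam' q)‖ :=
        (norm_add_le _ _).trans (add_le_add le_rfl (norm_sum_le _ _))
    _ ≤ (2 * Bc d) ^ d + ∑ _lam : Fin d, (2 * Bc d) * (2 ^ d * ((2 * Bc d) ^ d) ^ 3) :=
        add_le_add hU (Finset.sum_le_sum fun lam _ => hinner lam)
    _ = MFG d := by
        rw [Finset.sum_const, Finset.card_univ, Fintype.card_fin, nsmul_eq_mul]
        rfl

/-- the `F^G`-strip half-width `κ_{FG}(d) = min(r, c·r/(MFG·(d+1)))`, `c = ((4/π²)^d)^d/2`, `r = rOf d` — depends on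
`d` only. [folklore] -/
def kappaFG (d : ℕ) : ℝ :=
  min (rOf d) (((4 / Real.pi ^ 2) ^ d) ^ d / 2 * rOf d / (MFG d * ((d : ℝ) + 1)))

/-- `0 < κ_{FG}(d)`. [folklore] -/
theorem kappaFG_pos (d : ℕ) : 0 < kappaFG d := by
  unfold kappaFG
  have h1 := rOf_pos d
  have h2 := MFG_pos d
  have h3 : (0 : ℝ) < ((4 / Real.pi ^ 2) ^ d) ^ d / 2 := by positivity
  exact lt_min h1 (by positivity)

/-- `κ_{FG}(d) ≤ r`. [folklore] -/
theorem kappaFG_le_rOf (d : ℕ) : kappaFG d ≤ rOf d := min_le_left _ _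

/-- **`F^G` IS ZERO-FREE ON THE STRIP**: for `0 ≤ κ ≤ κ_{FG}(d)` and every `n ≥ 1`, `‖F^G(p)‖ ≥ ((4/π²)^d)^d/2` on
`Strip d κ`. [folklore] -/
theorem FG_lower (n : ℕ) [NeZero n] {κ : ℝ} (hκ0 : 0 ≤ κ) (hκ : κ ≤ kappaFG d) :
    ∀ p ∈ Strip d κ, ((4 / Real.pi ^ 2) ^ d) ^ d / 2 ≤ ‖FG n p‖ := by
  have hr := rOf_pos d
  have hκr : κ ≤ rOf d := hκ.trans (kappaFG_le_rOf d)
  have hMF := MFG_pos d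
  set c : ℝ := ((4 / Real.pi ^ 2) ^ d) ^ d / 2 with hc
  have hc0 : 0 < c := by positivity
  have hdiff : ∀ q ∈ Fat d (rOf d), ∀ μ, DifferentiableAt ℂ (fun w => FG n (Function.update q μ w)) (q μ) := by
    intro q hq μ
    have h := differentiableAt_FG n (rOf_le d) (d_mul_rOf_sq_le d) hq
    rw [← Function.update_eq_self μ q] at h
    exact h.comp (q μ) (differentiableAt_update q μ (q μ))
  have hlip := imLipschitz_of_fat (FG n) hr hκ0 hκr hdiff
    (fun q hq => norm_FG_le n (rOf_le d) (d_mul_rOf_sq_le d) hq)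
  refine strip_lower_bound (FG n) c (MFG d / rOf d) κ ?_ hlip (by positivity) ?_
  · intro s hs
    rw [hc]
    have := norm_FG_real_ge n s hs
    linarith
  · have hκ2 : κ ≤ c * rOf d / (MFG d * ((d : ℝ) + 1)) := hκ.trans (min_le_right _ _)
    have hd : (0 : ℝ) ≤ d := Nat.cast_nonneg d
    calc MFG d / rOf d * (d * κ) ≤ MFG d / rOf d * (d * (c * rOf d / (MFG d * ((d : ℝ) + 1)))) := by
          gcongr
      _ = c * (d / ((d : ℝ) + 1)) := by field_simp
      _ ≤ c * 1 := by
          gcongr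
          rw [div_le_one (by positivity)]
          linarith
      _ = c := mul_one c

/-- **THE STRIP HALF-WIDTH OF (1.83)**: `κ₁₈₃(d) = min(κ_N(d), κ_{YG}(d), κ_{FG}(d))` — depends on `d` only
(uniform in the lattice parameter `n = L^k` and in the alias indices). [folklore] -/
def kappa183 (d : ℕ) : ℝ := min (kappaN d) (min (kappaYG d) (kappaFG d))

/-- `0 < κ₁₈₃(d)`. [folklore] -/
theorem kappa183_pos (d : ℕ) : 0 < kappa183 d :=
  lt_min (kappaN_pos d) (lt_min (kappaYG_pos d) (kappaFG_pos d))

/-- `κ₁₈₃ ≤ κ_N`. [folklore] -/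
theorem kappa183_le_kappaN (d : ℕ) : kappa183 d ≤ kappaN d := min_le_left _ _

/-- `κ₁₈₃ ≤ κ_{YG}`. [folklore] -/
theorem kappa183_le_kappaYG (d : ℕ) : kappa183 d ≤ kappaYG d := (min_le_right _ _).trans (min_le_left _ _)

/-- `κ₁₈₃ ≤ κ_{FG}`. [folklore] -/
theorem kappa183_le_kappaFG (d : ℕ) : kappa183 d ≤ kappaFG d := (min_le_right _ _).trans (min_le_right _ _)

/-- `κ₁₈₃ ≤ r(d)`. [folklore] -/
theorem kappa183_le_rOf (d : ℕ) : kappa183 d ≤ rOf d := (kappa183_le_kappaN d).trans (kappaN_le_rOf d)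

/-- **THE ZERO-FREE STRIP (quantitative).**  On `Strip d κ`, `0 ≤ κ ≤ κ₁₈₃(d)`, for every `n ≥ 1`:
`‖F^G‖ ≥ ((4/π²)^d)^d/2`, `‖𝒩‖ ≥ (4/π²)^d/2`, `‖Y^G_λ‖ ≥ (4/π²)^{d+1}/2` (all `λ`), `‖Δ(p′+l)‖ ≥ 2` (all `l ≠ 0`).
[folklore] -/
theorem denominators_lower (n : ℕ) [NeZero n] {κ : ℝ} (hκ0 : 0 ≤ κ) (hκ : κ ≤ kappa183 d)
    {p : Fin d → ℂ} (hp : p ∈ Strip d κ) :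
    ((4 / Real.pi ^ 2) ^ d) ^ d / 2 ≤ ‖FG n p‖ ∧ (4 / Real.pi ^ 2) ^ d / 2 ≤ ‖Ncal n p‖ ∧
      (∀ lam, (4 / Real.pi ^ 2) ^ (d + 1) / 2 ≤ ‖YG n lam p‖) ∧
      ∀ k : Fin d → Fin n, k ≠ (fun _ => 0) → 2 ≤ ‖DeltaXi n 0 (shift n k p)‖ := by
  refine ⟨FG_lower n hκ0 (hκ.trans (kappa183_le_kappaFG d)) p hp,
    Ncal_lower n hκ0 (hκ.trans (kappa183_le_kappaN d)) p hp,
    fun lam => YG_lower n hκ0 (hκ.trans (kappa183_le_kappaYG d)) lam p hp, fun k hk => ?_⟩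
  exact norm_DeltaXi_shift_ge n 0 le_rfl (rOf_le d) (d_mul_rOf_sq_le d)
    (strip_subset_fat (rOf_pos d).le (hκ.trans (kappa183_le_rOf d)) hp) k hk

/-- **THE ZERO-FREE STRIP.**  On `Strip d κ`, `0 ≤ κ ≤ κ₁₈₃(d)`, every denominator of `g183` is nonzero, for every
`n ≥ 1` and all alias indices. [folklore] -/
theorem denominators_ne_zero (n : ℕ) [NeZero n] {κ : ℝ} (hκ0 : 0 ≤ κ) (hκ : κ ≤ kappa183 d)
    {p : Fin d → ℂ} (hp : p ∈ Strip d κ) :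
    FG n p ≠ 0 ∧ Ncal n p ≠ 0 ∧ (∀ lam, YG n lam p ≠ 0) ∧
      ∀ k : Fin d → Fin n, k ≠ (fun _ => 0) → DeltaXi n 0 (shift n k p) ≠ 0 := by
  obtain ⟨hF, hN, hY, hD⟩ := denominators_lower n hκ0 hκ hp
  have c1 : (0 : ℝ) < ((4 / Real.pi ^ 2) ^ d) ^ d / 2 := by positivity
  have c2 : (0 : ℝ) < (4 / Real.pi ^ 2) ^ d / 2 := by positivity
  have c3 : (0 : ℝ) < (4 / Real.pi ^ 2) ^ (d + 1) / 2 := by positivity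
  refine ⟨fun h => ?_, fun h => ?_, fun lam h => ?_, fun k hk h => ?_⟩
  · rw [h, norm_zero] at hF; linarith
  · rw [h, norm_zero] at hN; linarith
  · have := hY lam; rw [h, norm_zero] at this; linarith
  · have := hD k hk; rw [h, norm_zero] at this; linarith

end Strip


/-! ## §6. Holomorphy of the continued entry symbol on the zero-free strip -/

section Holo

variable (n : ℕ) [NeZero n]

omit [NeZero n] in
/-- `vC` is entire. [folklore] -/
theorem differentiable_vC (k : Fin d → Fin n) (μ : Fin d) :
    Differentiable ℂ (fun p : Fin d → ℂ => vC n k p μ) := by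
  intro q
  have hs : DifferentiableAt ℂ
      (fun p : Fin d → ℂ => (∑ j : Fin n, Complex.exp (shift n k p μ / n * I * ((j : ℕ) : ℂ))) * (n : ℂ)⁻¹) q :=
    (DifferentiableAt.fun_sum (fun j _ => (((differentiable_shiftPhase n k μ) q).mul_const _).cexp)).mul_const _
  have he : (fun p : Fin d → ℂ => vC n k p μ)
      = fun p => (∑ j : Fin n, Complex.exp (shift n k p μ / n * I * ((j : ℕ) : ℂ))) * (n : ℂ)⁻¹ := by
    funext p
    rw [vC, div_eq_mul_inv]
  rw [he]
  exact hs

omit [NeZero n] in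
/-- `uC` is entire. [folklore] -/
theorem differentiable_uC (k : Fin d → Fin n) :
    Differentiable ℂ (fun p : Fin d → ℂ => uC n k p) := by
  intro q
  unfold uC
  exact dAt_finset_prod _ _ q (fun μ _ => differentiable_vC n k μ q)

omit [NeZero n] in
/-- `dCbar` is entire. [folklore] -/
theorem differentiable_dCbar (k : Fin d → Fin n) (μ : Fin d) :
    Differentiable ℂ (fun p : Fin d → ℂ => dCbar n k p μ) := by
  unfold dCbar
  exact ((differentiable_shiftPhase n k μ).neg.cexp.sub_const 1).const_mul _

/-- `pairD` is holomorphic at fat points (`r ≤ 1/4`, `d r² ≤ 1/16`) unless `l = l′ = 0` (junk value, unused). [folklore] -/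
theorem differentiableAt_pairD {r : ℝ} (hr : r ≤ 1 / 4) (hdr : (d : ℝ) * r ^ 2 ≤ 1 / 16)
    {q : Fin d → ℂ} (hq : q ∈ Fat d r) (k k' : Fin d → Fin n) (hkk : ¬ (k = (fun _ => 0) ∧ k' = (fun _ => 0))) :
    DifferentiableAt ℂ (fun p : Fin d → ℂ => pairD n k k' p) q := by
  have hne : ∀ l : Fin d → Fin n, l ≠ (fun _ => 0) → DeltaXi n 0 (shift n l q) ≠ 0 := by
    intro l hl h
    have := norm_DeltaXi_shift_ge n 0 le_rfl hr hdr hq l hl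
    rw [h, norm_zero] at this
    linarith
  unfold pairD
  by_cases hk : k = fun _ => 0
  · have hk' : k' ≠ fun _ => 0 := fun h => hkk ⟨hk, h⟩
    simp only [hk, if_true]
    exact dAt_div (differentiableAt_const _) (differentiableAt_DeltaXi_shift n 0 k' q) (hne k' hk')
  · simp only [hk, if_false]
    by_cases hk' : k' = fun _ => 0
    · simp only [hk', if_true]
      exact dAt_div (differentiableAt_const _) (differentiableAt_DeltaXi_shift n 0 k q) (hne k hk)
    · simp only [hk', if_false]
      exact dAt_div (differentiableAt_DeltaXi n 0 q)
        ((differentiableAt_DeltaXi_shift n 0 k q).mul (differentiableAt_DeltaXi_shift n 0 k' q))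
        (mul_ne_zero (hne k hk) (hne k' hk'))

/-- **HOLOMORPHY OF THE CONTINUED ENTRY SYMBOL.**  For `0 ≤ κ ≤ κ₁₈₃(d)`, every `n ≥ 1`, all `μ, ν` and all alias
indices `l, l′`, `p′ ↦ g183 μ ν l l′ (p′)` is holomorphic (jointly on `ℂ^d`) at every point of `Strip d κ`. [folklore] -/
theorem differentiableAt_g183 {κ : ℝ} (hκ0 : 0 ≤ κ) (hκ : κ ≤ kappa183 d) {p : Fin d → ℂ}
    (hp : p ∈ Strip d κ) (μ ν : Fin d) (k k' : Fin d → Fin n) :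
    DifferentiableAt ℂ (fun q : Fin d → ℂ => g183 n μ ν k k' q) p := by
  have hr := rOf_le d
  have hdr := d_mul_rOf_sq_le d
  have hq : p ∈ Fat d (rOf d) := strip_subset_fat (rOf_pos d).le (hκ.trans (kappa183_le_rOf d)) hp
  obtain ⟨hF, hN, hY, hD⟩ := denominators_ne_zero n hκ0 hκ hp
  -- leaves
  have dY : ∀ lam, DifferentiableAt ℂ (fun q : Fin d → ℂ => YG n lam q) p :=
    fun lam => differentiableAt_YG n hr hdr hq lam
  have dR : ∀ lam, DifferentiableAt ℂ (fun q : Fin d → ℂ => RG n lam q) p :=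
    fun lam => differentiableAt_RG n hr hdr hq lam
  have dN : DifferentiableAt ℂ (fun q : Fin d → ℂ => Ncal n q) p := differentiableAt_Ncal n hr hdr hq
  have dX : DifferentiableAt ℂ (fun q : Fin d → ℂ => Xne n q) p := differentiableAt_Xne n hr hdr hq
  have dΔ : DifferentiableAt ℂ (fun q : Fin d → ℂ => DeltaXi n 0 q) p := differentiableAt_DeltaXi n 0 p
  have dΔk : ∀ l : Fin d → Fin n, DifferentiableAt ℂ (fun q : Fin d → ℂ => DeltaXi n 0 (shift n l q)) p :=
    fun l => differentiableAt_DeltaXi_shift n 0 l p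
  have dΔk0 : ∀ l : Fin d → Fin n, DifferentiableAt ℂ (fun q : Fin d → ℂ => DeltaXi n 0 (shift n l q)) p
      ∧ (l ≠ (fun _ => 0) → DeltaXi n 0 (shift n l p) ≠ 0) := fun l => ⟨dΔk l, fun hl => hD l hl⟩
  -- the diagonal part
  have dDiag : DifferentiableAt ℂ (fun q : Fin d → ℂ => diagG n μ k k' q) p := by
    unfold diagG
    by_cases hkk : k = (fun _ => 0) ∧ k' = (fun _ => 0)
    · simp only [hkk, and_self, if_true]
      exact dAt_div (dR μ) (dY μ) (hY μ)
    · simp only [hkk, if_false]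
      refine DifferentiableAt.sub ?_ ?_
      · by_cases he : k = k'
        · simp only [he, if_true]
          have hk' : k' ≠ fun _ => 0 := fun h => hkk ⟨he.trans h, h⟩
          exact dAt_div (differentiableAt_const _) (dΔk k') (hD k' hk')
        · simp only [he, if_false]
          exact differentiableAt_const _
      · refine dAt_div ?_ (dY μ) (hY μ)
        exact ((((differentiable_uCbar n k p).mul (differentiable_vCbar n k μ p)).mul
          ((differentiable_uC n k' p).mul (differentiable_vC n k' μ p))).mul
          (differentiableAt_pairD n hr hdr hq k k' hkk))
  -- the brackets
  have dB1 : DifferentiableAt ℂ (fun q : Fin d → ℂ => B1 n μ k q) p := by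
    unfold B1
    by_cases hk : k = fun _ => 0
    · simp only [hk, if_true]
      refine dAt_div ?_ (dN.mul (dY μ)) (mul_ne_zero hN (hY μ))
      refine (differentiable_uCbar n _ p).mul ?_
      exact ((differentiable_dC n _ μ p).mul (dR μ)).sub
        ((((differentiable_vCbar n _ μ p).mul (differentiable_expFacPos μ p)).mul dΔ).mul dX)
    · simp only [hk, if_false]
      refine (differentiable_uCbar n k p).mul (DifferentiableAt.sub ?_ ?_)
      · exact dAt_div ((differentiable_dC n k μ p).mul dΔ) (((dΔk k).pow 2).mul dN)
          (mul_ne_zero (pow_ne_zero 2 (hD k hk)) hN)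
      · exact dAt_div ((differentiable_vCbar n k μ p).mul (differentiable_expFacPos μ p))
          ((dY μ).mul (dΔk k)) (mul_ne_zero (hY μ) (hD k hk))
  have dB2 : DifferentiableAt ℂ (fun q : Fin d → ℂ => B2 n ν k' q) p := by
    unfold B2
    by_cases hk : k' = fun _ => 0
    · simp only [hk, if_true]
      refine dAt_div ?_ (dN.mul (dY ν)) (mul_ne_zero hN (hY ν))
      refine (differentiable_uC n _ p).mul ?_
      exact ((differentiable_dCbar n _ ν p).mul (dR ν)).sub
        ((((differentiable_vC n _ ν p).mul (differentiable_expFacNeg ν p)).mul dΔ).mul dX)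
    · simp only [hk, if_false]
      refine (differentiable_uC n k' p).mul (DifferentiableAt.sub ?_ ?_)
      · exact dAt_div ((differentiable_dCbar n k' ν p).mul dΔ) (((dΔk k').pow 2).mul dN)
          (mul_ne_zero (pow_ne_zero 2 (hD k' hk)) hN)
      · exact dAt_div ((differentiable_vC n k' ν p).mul (differentiable_expFacNeg ν p))
          ((dY ν).mul (dΔk k')) (mul_ne_zero (hY ν) (hD k' hk))
  have dMid : DifferentiableAt ℂ (fun q : Fin d → ℂ => midG n q) p := by
    unfold midG
    exact dAt_div (dAt_finset_prod _ _ p (fun lam _ => dY lam)) (differentiableAt_FG n hr hdr hq) hF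
  unfold g183
  refine DifferentiableAt.add ?_ ((dMid.mul dB1).mul dB2)
  by_cases hμν : μ = ν
  · simp only [hμν, if_true]
    exact hμν ▸ dDiag
  · simp only [hμν, if_false]
    exact differentiableAt_const _

end Holo


/-! ## §7. The uniform bound on the zero-free strip (`d`-only; uniform in `n ≥ 1`, `μ, ν` and the alias indices)

The remaining leaf bounds (`u`, `v_ν`, `conj ∂_ν·u`, `conj ∂_ν·v_ν`) follow from those of `B5Hk163Strip` §6 by the
conjugation symmetry `uC(p) = conj ūC(p̄)`, `vC(p) = conj v̄C(p̄)`, `dCbar(p) = conj dC(p̄)` and the invariance of the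
fat region under `p ↦ p̄`.  Constants are crude and explicit in `d`; none is attributed to print. -/

section Bounds

variable (n : ℕ) [NeZero n]

/-- componentwise complex conjugation of a (complex) momentum vector. [folklore] -/
def conjVec (p : Fin d → ℂ) : Fin d → ℂ := fun μ => conj (p μ)

/-- the fat region is invariant under conjugation. [folklore] -/
theorem conjVec_mem_fat {r : ℝ} {q : Fin d → ℂ} (hq : q ∈ Fat d r) : conjVec q ∈ Fat d r := by
  intro ν
  obtain ⟨h1, h2⟩ := hq ν
  refine ⟨?_, ?_⟩
  · simpa [conjVec, Complex.conj_re] using h1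
  · simpa [conjVec, Complex.conj_im, abs_neg] using h2

omit [NeZero n] in
/-- `shift` commutes with conjugation (the alias shifts are real). [folklore] -/
theorem shift_conjVec (k : Fin d → Fin n) (p : Fin d → ℂ) (μ : Fin d) :
    shift n k (conjVec p) μ = conj (shift n k p μ) := by
  simp only [shift, conjVec, map_add, map_mul, map_ofNat, Complex.conj_ofReal, map_natCast]

omit [NeZero n] in
/-- conjugation symmetry `vC(p) = conj v̄C(p̄)`. [folklore] -/
theorem vC_eq_conj (k : Fin d → Fin n) (p : Fin d → ℂ) (μ : Fin d) :
    vC n k p μ = conj (vCbar n k (conjVec p) μ) := by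
  unfold vC vCbar
  rw [map_div₀, map_natCast, map_sum]
  congr 1
  refine Finset.sum_congr rfl (fun j _ => ?_)
  rw [← Complex.exp_conj, shift_conjVec]
  congr 1
  simp only [map_neg, map_mul, map_div₀, map_natCast, Complex.conj_conj, Complex.conj_I]
  ring

omit [NeZero n] in
/-- conjugation symmetry `uC(p) = conj ūC(p̄)`. [folklore] -/
theorem uC_eq_conj (k : Fin d → Fin n) (p : Fin d → ℂ) : uC n k p = conj (uCbar n k (conjVec p)) := by
  unfold uC uCbar
  rw [map_prod]
  exact Finset.prod_congr rfl (fun μ _ => vC_eq_conj n k p μ)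

omit [NeZero n] in
/-- conjugation symmetry `dCbar(p) = conj dC(p̄)`. [folklore] -/
theorem dCbar_eq_conj (k : Fin d → Fin n) (p : Fin d → ℂ) (μ : Fin d) :
    dCbar n k p μ = conj (dC n k (conjVec p) μ) := by
  unfold dCbar dC
  rw [map_mul, map_natCast, map_sub, map_one, ← Complex.exp_conj, shift_conjVec]
  congr 3
  simp only [map_mul, map_div₀, map_natCast, Complex.conj_conj, Complex.conj_I]
  ring

/-- `‖v_μ(p′+l)‖ ≤ 2` on the fat region, all `n`, all `l`. [folklore] -/
theorem norm_vC_le {r : ℝ} (hr : r ≤ 1 / 4) {q : Fin d → ℂ} (hq : q ∈ Fat d r) (k : Fin d → Fin n) (μ : Fin d) :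
    ‖vC n k q μ‖ ≤ 2 := by
  rw [vC_eq_conj, Complex.norm_conj]; exact norm_vCbar_le n hr (conjVec_mem_fat hq) k μ

/-- `‖u(p′+l)‖ ≤ 2^d` on the fat region, all `n`, all `l`. [folklore] -/
theorem norm_uC_le {r : ℝ} (hr : r ≤ 1 / 4) {q : Fin d → ℂ} (hq : q ∈ Fat d r) (k : Fin d → Fin n) :
    ‖uC n k q‖ ≤ 2 ^ d := by
  rw [uC_eq_conj, Complex.norm_conj]; exact norm_uCbar_le n hr (conjVec_mem_fat hq) k

/-- `‖conj ∂_μ(p′+l) · v_μ(p′+l)‖ ≤ 4` on the fat region, all `n`, all `l`. [folklore] -/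
theorem norm_dCbar_mul_vC_le {r : ℝ} (hr : r ≤ 1 / 4) {q : Fin d → ℂ} (hq : q ∈ Fat d r)
    (k : Fin d → Fin n) (μ : Fin d) : ‖dCbar n k q μ * vC n k q μ‖ ≤ 4 := by
  rw [dCbar_eq_conj, vC_eq_conj, ← map_mul, Complex.norm_conj]
  exact norm_dC_mul_vCbar_le n hr (conjVec_mem_fat hq) k μ

/-- `‖conj ∂_μ(p′+l) · u(p′+l)‖ ≤ 4·2^d` on the fat region, all `n`, all `l`. [folklore] -/
theorem norm_dCbar_mul_uC_le {r : ℝ} (hr : r ≤ 1 / 4) {q : Fin d → ℂ} (hq : q ∈ Fat d r)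
    (k : Fin d → Fin n) (μ : Fin d) : ‖dCbar n k q μ * uC n k q‖ ≤ 4 * 2 ^ d := by
  rw [dCbar_eq_conj, uC_eq_conj, ← map_mul, Complex.norm_conj]
  exact norm_dC_mul_uCbar_le n hr (conjVec_mem_fat hq) k μ

/-- norm of a product from bounds on the factors. [folklore] -/
private theorem nmul_le {a b : ℂ} {A B : ℝ} (ha : ‖a‖ ≤ A) (hb : ‖b‖ ≤ B) : ‖a * b‖ ≤ A * B := by
  rw [norm_mul]; exact mul_le_mul ha hb (norm_nonneg _) ((norm_nonneg _).trans ha)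

/-- norm of a difference from bounds on the terms. [folklore] -/
private theorem nsub_le {a b : ℂ} {A B : ℝ} (ha : ‖a‖ ≤ A) (hb : ‖b‖ ≤ B) : ‖a - b‖ ≤ A + B :=
  (norm_sub_le a b).trans (add_le_add ha hb)

/-- norm of a sum from bounds on the terms. [folklore] -/
private theorem nadd_le {a b : ℂ} {A B : ℝ} (ha : ‖a‖ ≤ A) (hb : ‖b‖ ≤ B) : ‖a + b‖ ≤ A + B :=
  (norm_add_le a b).trans (add_le_add ha hb)

/-- `‖e^{∓ip_a} − 1‖ ≤ 4` on a strip of half-width `κ ≤ 1`. [folklore] -/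
theorem norm_expFac_le_four {κ : ℝ} (hκ : κ ≤ 1) {p : Fin d → ℂ} (hp : p ∈ Strip d κ) (a : Fin d) :
    ‖expFacNeg a p‖ ≤ 4 ∧ ‖expFacPos a p‖ ≤ 4 := by
  have h := norm_expFac_le hp a
  have he : Real.exp κ + 1 ≤ 4 := by
    have h1 : Real.exp κ ≤ Real.exp 1 := Real.exp_le_exp.mpr hκ
    have h2 := Real.exp_one_lt_d9
    linarith
  exact ⟨h.1.trans he, h.2.trans he⟩

/-- `‖P(l,l′)‖ ≤ B` on the zero-free strip unless `l = l′ = 0`. [folklore] -/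
theorem norm_pairD_le {κ : ℝ} (hκ0 : 0 ≤ κ) (hκ : κ ≤ kappa183 d) {p : Fin d → ℂ} (hp : p ∈ Strip d κ)
    (k k' : Fin d → Fin n) (hkk : ¬ (k = (fun _ => 0) ∧ k' = (fun _ => 0))) : ‖pairD n k k' p‖ ≤ Bc d := by
  have hr := rOf_le d
  have hq : p ∈ Fat d (rOf d) := strip_subset_fat (rOf_pos d).le (hκ.trans (kappa183_le_rOf d)) hp
  obtain ⟨-, -, -, hD⟩ := denominators_lower n hκ0 hκ hp
  have hB := one_le_Bc d
  have h1 : ‖(1 : ℂ)‖ ≤ 1 := by simp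
  unfold pairD
  by_cases hk : k = fun _ => 0
  · have hk' : k' ≠ fun _ => 0 := fun h => hkk ⟨hk, h⟩
    rw [if_pos hk]
    calc ‖1 / DeltaXi n 0 (shift n k' p)‖ ≤ 1 / 2 := norm_div_le_of h1 two_pos (hD k' hk')
      _ ≤ Bc d := by linarith
  · rw [if_neg hk]
    by_cases hk' : k' = fun _ => 0
    · rw [if_pos hk']
      calc ‖1 / DeltaXi n 0 (shift n k p)‖ ≤ 1 / 2 := norm_div_le_of h1 two_pos (hD k hk)
        _ ≤ Bc d := by linarith
    · rw [if_neg hk']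
      have hprod : (2 : ℝ) * 2 ≤ ‖DeltaXi n 0 (shift n k p) * DeltaXi n 0 (shift n k' p)‖ := by
        rw [norm_mul]; exact mul_le_mul (hD k hk) (hD k' hk') (by norm_num) (norm_nonneg _)
      calc ‖DeltaXi n 0 p / (DeltaXi n 0 (shift n k p) * DeltaXi n 0 (shift n k' p))‖
          ≤ Bc d / (2 * 2) := norm_div_le_of (norm_DeltaXi0_le_Bc n hr hq) (by norm_num) hprod
        _ ≤ Bc d := by linarith

/-- the explicit bound of the `δ_{μν}`-part `diagG` (depends on `d` only). [folklore] -/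
def MD183 (d : ℕ) : ℝ := 2 * Bc d / cY163 d + (1 / 2 + 2 ^ d * 2 * (2 ^ d * 2) * Bc d / cY163 d)

/-- `0 ≤ MD183 d`. [folklore] -/
theorem MD183_nonneg (d : ℕ) : 0 ≤ MD183 d := by
  unfold MD183
  have hB := (Bc_pos d).le
  have hc : 0 ≤ cY163 d := by unfold cY163; positivity
  have h1 : 0 ≤ 2 * Bc d / cY163 d := div_nonneg (by linarith) hc
  have h2 : 0 ≤ 2 ^ d * 2 * (2 ^ d * 2) * Bc d / cY163 d := div_nonneg (mul_nonneg (by positivity) hB) hc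
  linarith

/-- **bound of the first + second term**: `‖diagG‖ ≤ MD183 d` on the zero-free strip, all `n`, `μ`, `l, l′`. [folklore] -/
theorem norm_diagG_le {κ : ℝ} (hκ0 : 0 ≤ κ) (hκ : κ ≤ kappa183 d) {p : Fin d → ℂ} (hp : p ∈ Strip d κ)
    (μ : Fin d) (k k' : Fin d → Fin n) : ‖diagG n μ k k' p‖ ≤ MD183 d := by
  have hr := rOf_le d
  have hdr := d_mul_rOf_sq_le d
  have hq : p ∈ Fat d (rOf d) := strip_subset_fat (rOf_pos d).le (hκ.trans (kappa183_le_rOf d)) hp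
  obtain ⟨-, -, hY, hD⟩ := denominators_lower n hκ0 hκ hp
  have hcY : 0 < cY163 d := by unfold cY163; positivity
  have hYμ : cY163 d ≤ ‖YG n μ p‖ := hY μ
  have hB := (Bc_pos d).le
  have hpos1 : 0 ≤ 2 * Bc d / cY163 d := div_nonneg (by linarith) hcY.le
  have hpos2 : 0 ≤ 1 / 2 + 2 ^ d * 2 * (2 ^ d * 2) * Bc d / cY163 d := by
    have : 0 ≤ 2 ^ d * 2 * (2 ^ d * 2) * Bc d / cY163 d := div_nonneg (mul_nonneg (by positivity) hB) hcY.le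
    linarith
  unfold diagG
  by_cases hkk : k = (fun _ => 0) ∧ k' = (fun _ => 0)
  · rw [if_pos hkk]
    have t1 : ‖RG n μ p / YG n μ p‖ ≤ 2 * Bc d / cY163 d := norm_div_le_of (norm_RG_le n hr hdr hq μ) hcY hYμ
    unfold MD183
    linarith
  · rw [if_neg hkk]
    have hite : ‖(if k = k' then 1 / DeltaXi n 0 (shift n k p) else 0 : ℂ)‖ ≤ 1 / 2 := by
      by_cases he : k = k'
      · rw [if_pos he]
        have hk : k ≠ fun _ => 0 := fun h => hkk ⟨h, he.symm.trans h⟩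
        exact norm_div_le_of (by simp) two_pos (hD k hk)
      · rw [if_neg he, norm_zero]; norm_num
    have hnum : ‖uCbar n k p * vCbar n k p μ * (uC n k' p * vC n k' p μ) * pairD n k k' p‖
        ≤ 2 ^ d * 2 * (2 ^ d * 2) * Bc d :=
      nmul_le (nmul_le (nmul_le (norm_uCbar_le n hr hq k) (norm_vCbar_le n hr hq k μ))
        (nmul_le (norm_uC_le n hr hq k') (norm_vC_le n hr hq k' μ))) (norm_pairD_le n hκ0 hκ hp k k' hkk)
    have hfrac := norm_div_le_of hnum hcY hYμ
    calc ‖(if k = k' then 1 / DeltaXi n 0 (shift n k p) else 0)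
          - uCbar n k p * vCbar n k p μ * (uC n k' p * vC n k' p μ) * pairD n k k' p / YG n μ p‖
        ≤ 1 / 2 + 2 ^ d * 2 * (2 ^ d * 2) * Bc d / cY163 d := nsub_le hite hfrac
      _ ≤ MD183 d := by unfold MD183; linarith

/-- the explicit bound of the brackets `B1`, `B2` (depends on `d` only). [folklore] -/
def MB183 (d : ℕ) : ℝ :=
  (4 * 2 ^ d * (2 * Bc d) + 2 ^ d * 2 * 4 * Bc d * (132 ^ d / 4)) / (cN163 d * cY163 d)
    + (4 * 2 ^ d * Bc d / (2 * 2 * cN163 d) + 2 ^ d * 2 * 4 / (cY163 d * 2))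

/-- the two summands of `MB183` are `≥ 0`. [folklore] -/
theorem MB183_parts_nonneg (d : ℕ) :
    0 ≤ (4 * 2 ^ d * (2 * Bc d) + 2 ^ d * 2 * 4 * Bc d * (132 ^ d / 4)) / (cN163 d * cY163 d) ∧
    0 ≤ 4 * 2 ^ d * Bc d / (2 * 2 * cN163 d) + 2 ^ d * 2 * 4 / (cY163 d * 2) := by
  have hB := (Bc_pos d).le
  have hcY : 0 ≤ cY163 d := by unfold cY163; positivity
  have hcN : 0 ≤ cN163 d := by unfold cN163; positivity
  refine ⟨div_nonneg ?_ (mul_nonneg hcN hcY), add_nonneg (div_nonneg ?_ (by positivity)) (div_nonneg ?_ ?_)⟩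
  · have h1 : 0 ≤ 4 * 2 ^ d * (2 * Bc d) := by positivity
    have h2 : 0 ≤ 2 ^ d * 2 * 4 * Bc d * (132 ^ d / 4) := by positivity
    linarith
  · positivity
  · positivity
  · positivity

/-- **bound of the first bracket**: `‖B1(l,μ)‖ ≤ MB183 d` on the zero-free strip, all `n`, `μ`, `l`. [folklore] -/
theorem norm_B1_le {κ : ℝ} (hκ0 : 0 ≤ κ) (hκ : κ ≤ kappa183 d) {p : Fin d → ℂ} (hp : p ∈ Strip d κ)
    (μ : Fin d) (k : Fin d → Fin n) : ‖B1 n μ k p‖ ≤ MB183 d := by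
  have hr := rOf_le d
  have hdr := d_mul_rOf_sq_le d
  have hq : p ∈ Fat d (rOf d) := strip_subset_fat (rOf_pos d).le (hκ.trans (kappa183_le_rOf d)) hp
  obtain ⟨-, hN, hY, hD⟩ := denominators_lower n hκ0 hκ hp
  have hκ1 : κ ≤ 1 := (hκ.trans (kappa183_le_rOf d)).trans ((rOf_le d).trans (by norm_num))
  have hcY : 0 < cY163 d := by unfold cY163; positivity
  have hcN : 0 < cN163 d := by unfold cN163; positivity
  have hYμ : cY163 d ≤ ‖YG n μ p‖ := hY μ
  have hNl : cN163 d ≤ ‖Ncal n p‖ := hN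
  have hE := (norm_expFac_le_four hκ1 hp μ).2
  have hΔ := norm_DeltaXi0_le_Bc n hr hq
  have hX := norm_Xne_le n hr hdr hq
  obtain ⟨hposA, hposB⟩ := MB183_parts_nonneg d
  by_cases hk : k = fun _ => 0
  · have heq : B1 n μ k p = (dC n k p μ * uCbar n k p * RG n μ p
        - uCbar n k p * vCbar n k p μ * expFacPos μ p * DeltaXi n 0 p * Xne n p) / (Ncal n p * YG n μ p) := by
      unfold B1; rw [if_pos hk]; ring
    rw [heq]
    have hnum : ‖dC n k p μ * uCbar n k p * RG n μ p
          - uCbar n k p * vCbar n k p μ * expFacPos μ p * DeltaXi n 0 p * Xne n p‖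
        ≤ 4 * 2 ^ d * (2 * Bc d) + 2 ^ d * 2 * 4 * Bc d * (132 ^ d / 4) :=
      nsub_le (nmul_le (norm_dC_mul_uCbar_le n hr hq k μ) (norm_RG_le n hr hdr hq μ))
        (nmul_le (nmul_le (nmul_le (nmul_le (norm_uCbar_le n hr hq k) (norm_vCbar_le n hr hq k μ)) hE) hΔ) hX)
    have hden : cN163 d * cY163 d ≤ ‖Ncal n p * YG n μ p‖ := by
      rw [norm_mul]; exact mul_le_mul hNl hYμ hcY.le (norm_nonneg _)
    calc _ ≤ (4 * 2 ^ d * (2 * Bc d) + 2 ^ d * 2 * 4 * Bc d * (132 ^ d / 4)) / (cN163 d * cY163 d) :=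
          norm_div_le_of hnum (mul_pos hcN hcY) hden
      _ ≤ MB183 d := by unfold MB183; linarith
  · have heq : B1 n μ k p
        = dC n k p μ * uCbar n k p * (DeltaXi n 0 p / (DeltaXi n 0 (shift n k p) ^ 2 * Ncal n p))
          - uCbar n k p * vCbar n k p μ * expFacPos μ p / (YG n μ p * DeltaXi n 0 (shift n k p)) := by
      unfold B1; rw [if_neg hk]; ring
    rw [heq]
    have hDk := hD k hk
    have hden1 : 2 * 2 * cN163 d ≤ ‖DeltaXi n 0 (shift n k p) ^ 2 * Ncal n p‖ := by
      rw [norm_mul, norm_pow]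
      have h2 : (2 : ℝ) * 2 ≤ ‖DeltaXi n 0 (shift n k p)‖ ^ 2 := by
        nlinarith [hDk, norm_nonneg (DeltaXi n 0 (shift n k p))]
      exact mul_le_mul h2 hNl hcN.le (by positivity)
    have hden2 : cY163 d * 2 ≤ ‖YG n μ p * DeltaXi n 0 (shift n k p)‖ := by
      rw [norm_mul]; exact mul_le_mul hYμ hDk (by norm_num) (norm_nonneg _)
    have t1 : ‖dC n k p μ * uCbar n k p * (DeltaXi n 0 p / (DeltaXi n 0 (shift n k p) ^ 2 * Ncal n p))‖
        ≤ 4 * 2 ^ d * (Bc d / (2 * 2 * cN163 d)) :=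
      nmul_le (norm_dC_mul_uCbar_le n hr hq k μ)
        (norm_div_le_of hΔ (mul_pos (mul_pos two_pos two_pos) hcN) hden1)
    have t2 : ‖uCbar n k p * vCbar n k p μ * expFacPos μ p / (YG n μ p * DeltaXi n 0 (shift n k p))‖
        ≤ 2 ^ d * 2 * 4 / (cY163 d * 2) :=
      norm_div_le_of (nmul_le (nmul_le (norm_uCbar_le n hr hq k) (norm_vCbar_le n hr hq k μ)) hE)
        (mul_pos hcY two_pos) hden2
    have h3 : 4 * 2 ^ d * (Bc d / (2 * 2 * cN163 d)) = 4 * 2 ^ d * Bc d / (2 * 2 * cN163 d) := by ring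
    calc _ ≤ 4 * 2 ^ d * (Bc d / (2 * 2 * cN163 d)) + 2 ^ d * 2 * 4 / (cY163 d * 2) := nsub_le t1 t2
      _ ≤ MB183 d := by unfold MB183; rw [h3]; linarith

/-- **bound of the second bracket**: `‖B2(l′,ν)‖ ≤ MB183 d` on the zero-free strip, all `n`, `ν`, `l′`. [folklore] -/
theorem norm_B2_le {κ : ℝ} (hκ0 : 0 ≤ κ) (hκ : κ ≤ kappa183 d) {p : Fin d → ℂ} (hp : p ∈ Strip d κ)
    (ν : Fin d) (k' : Fin d → Fin n) : ‖B2 n ν k' p‖ ≤ MB183 d := by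
  have hr := rOf_le d
  have hdr := d_mul_rOf_sq_le d
  have hq : p ∈ Fat d (rOf d) := strip_subset_fat (rOf_pos d).le (hκ.trans (kappa183_le_rOf d)) hp
  obtain ⟨-, hN, hY, hD⟩ := denominators_lower n hκ0 hκ hp
  have hκ1 : κ ≤ 1 := (hκ.trans (kappa183_le_rOf d)).trans ((rOf_le d).trans (by norm_num))
  have hcY : 0 < cY163 d := by unfold cY163; positivity
  have hcN : 0 < cN163 d := by unfold cN163; positivity
  have hYν : cY163 d ≤ ‖YG n ν p‖ := hY ν
  have hNl : cN163 d ≤ ‖Ncal n p‖ := hN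
  have hE := (norm_expFac_le_four hκ1 hp ν).1
  have hΔ := norm_DeltaXi0_le_Bc n hr hq
  have hX := norm_Xne_le n hr hdr hq
  obtain ⟨hposA, hposB⟩ := MB183_parts_nonneg d
  by_cases hk : k' = fun _ => 0
  · have heq : B2 n ν k' p = (dCbar n k' p ν * uC n k' p * RG n ν p
        - uC n k' p * vC n k' p ν * expFacNeg ν p * DeltaXi n 0 p * Xne n p) / (Ncal n p * YG n ν p) := by
      unfold B2; rw [if_pos hk]; ring
    rw [heq]
    have hnum : ‖dCbar n k' p ν * uC n k' p * RG n ν p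
          - uC n k' p * vC n k' p ν * expFacNeg ν p * DeltaXi n 0 p * Xne n p‖
        ≤ 4 * 2 ^ d * (2 * Bc d) + 2 ^ d * 2 * 4 * Bc d * (132 ^ d / 4) :=
      nsub_le (nmul_le (norm_dCbar_mul_uC_le n hr hq k' ν) (norm_RG_le n hr hdr hq ν))
        (nmul_le (nmul_le (nmul_le (nmul_le (norm_uC_le n hr hq k') (norm_vC_le n hr hq k' ν)) hE) hΔ) hX)
    have hden : cN163 d * cY163 d ≤ ‖Ncal n p * YG n ν p‖ := by
      rw [norm_mul]; exact mul_le_mul hNl hYν hcY.le (norm_nonneg _)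
    calc _ ≤ (4 * 2 ^ d * (2 * Bc d) + 2 ^ d * 2 * 4 * Bc d * (132 ^ d / 4)) / (cN163 d * cY163 d) :=
          norm_div_le_of hnum (mul_pos hcN hcY) hden
      _ ≤ MB183 d := by unfold MB183; linarith
  · have heq : B2 n ν k' p
        = dCbar n k' p ν * uC n k' p * (DeltaXi n 0 p / (DeltaXi n 0 (shift n k' p) ^ 2 * Ncal n p))
          - uC n k' p * vC n k' p ν * expFacNeg ν p / (YG n ν p * DeltaXi n 0 (shift n k' p)) := by
      unfold B2; rw [if_neg hk]; ring
    rw [heq]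
    have hDk := hD k' hk
    have hden1 : 2 * 2 * cN163 d ≤ ‖DeltaXi n 0 (shift n k' p) ^ 2 * Ncal n p‖ := by
      rw [norm_mul, norm_pow]
      have h2 : (2 : ℝ) * 2 ≤ ‖DeltaXi n 0 (shift n k' p)‖ ^ 2 := by
        nlinarith [hDk, norm_nonneg (DeltaXi n 0 (shift n k' p))]
      exact mul_le_mul h2 hNl hcN.le (by positivity)
    have hden2 : cY163 d * 2 ≤ ‖YG n ν p * DeltaXi n 0 (shift n k' p)‖ := by
      rw [norm_mul]; exact mul_le_mul hYν hDk (by norm_num) (norm_nonneg _)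
    have t1 : ‖dCbar n k' p ν * uC n k' p * (DeltaXi n 0 p / (DeltaXi n 0 (shift n k' p) ^ 2 * Ncal n p))‖
        ≤ 4 * 2 ^ d * (Bc d / (2 * 2 * cN163 d)) :=
      nmul_le (norm_dCbar_mul_uC_le n hr hq k' ν)
        (norm_div_le_of hΔ (mul_pos (mul_pos two_pos two_pos) hcN) hden1)
    have t2 : ‖uC n k' p * vC n k' p ν * expFacNeg ν p / (YG n ν p * DeltaXi n 0 (shift n k' p))‖
        ≤ 2 ^ d * 2 * 4 / (cY163 d * 2) :=
      norm_div_le_of (nmul_le (nmul_le (norm_uC_le n hr hq k') (norm_vC_le n hr hq k' ν)) hE)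
        (mul_pos hcY two_pos) hden2
    have h3 : 4 * 2 ^ d * (Bc d / (2 * 2 * cN163 d)) = 4 * 2 ^ d * Bc d / (2 * 2 * cN163 d) := by ring
    calc _ ≤ 4 * 2 ^ d * (Bc d / (2 * 2 * cN163 d)) + 2 ^ d * 2 * 4 / (cY163 d * 2) := nsub_le t1 t2
      _ ≤ MB183 d := by unfold MB183; rw [h3]; linarith

/-- the explicit bound of the scalar `Π_νY^G_ν/F^G` (depends on `d` only). [folklore] -/
def Mmid183 (d : ℕ) : ℝ := (3 * Bc d ^ 2) ^ d / cF163 d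

/-- `0 ≤ Mmid183 d`. [folklore] -/
theorem Mmid183_nonneg (d : ℕ) : 0 ≤ Mmid183 d := by
  unfold Mmid183
  have hB := (Bc_pos d).le
  have hc : 0 ≤ cF163 d := by unfold cF163; positivity
  exact div_nonneg (by positivity) hc

/-- **bound of the scalar between the brackets**: `‖midG‖ ≤ Mmid183 d` on the zero-free strip, all `n`. [folklore] -/
theorem norm_midG_le {κ : ℝ} (hκ0 : 0 ≤ κ) (hκ : κ ≤ kappa183 d) {p : Fin d → ℂ} (hp : p ∈ Strip d κ) :
    ‖midG n p‖ ≤ Mmid183 d := by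
  have hr := rOf_le d
  have hdr := d_mul_rOf_sq_le d
  have hq : p ∈ Fat d (rOf d) := strip_subset_fat (rOf_pos d).le (hκ.trans (kappa183_le_rOf d)) hp
  obtain ⟨hF, -, -, -⟩ := denominators_lower n hκ0 hκ hp
  have hcF : 0 < cF163 d := by unfold cF163; positivity
  have hFl : cF163 d ≤ ‖FG n p‖ := hF
  have h3 : (1 : ℝ) ≤ 3 * Bc d ^ 2 := by nlinarith [one_le_Bc d]
  have hnum : ‖∏ lam, YG n lam p‖ ≤ (3 * Bc d ^ 2) ^ d :=
    norm_prod_le_pow _ _ h3 (by simp) (fun lam _ => norm_YG_le n hr hdr hq lam)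
  unfold midG Mmid183
  exact norm_div_le_of hnum hcF hFl

/-- **THE UNIFORM BOUND OF THE CONTINUED (1.83) ENTRY SYMBOL** (depends on `d` only). [folklore] -/
def M183 (d : ℕ) : ℝ := MD183 d + Mmid183 d * MB183 d * MB183 d

/-- **`‖g183‖ ≤ M183 d` ON THE ZERO-FREE STRIP**, for `0 ≤ κ ≤ κ₁₈₃(d)`, every `n ≥ 1`, all `μ, ν` and ALL alias
indices `l, l′` (the bound is uniform in the lattice parameter and in the fiber). [folklore] -/
theorem norm_g183_le {κ : ℝ} (hκ0 : 0 ≤ κ) (hκ : κ ≤ kappa183 d) {p : Fin d → ℂ} (hp : p ∈ Strip d κ)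
    (μ ν : Fin d) (k k' : Fin d → Fin n) : ‖g183 n μ ν k k' p‖ ≤ M183 d := by
  have h1 : ‖(if μ = ν then diagG n μ k k' p else 0 : ℂ)‖ ≤ MD183 d := by
    by_cases h : μ = ν
    · rw [if_pos h]; exact norm_diagG_le n hκ0 hκ hp μ k k'
    · rw [if_neg h, norm_zero]; exact MD183_nonneg d
  have h2 := nmul_le (nmul_le (norm_midG_le n hκ0 hκ hp) (norm_B1_le n hκ0 hκ hp μ k)) (norm_B2_le n hκ0 hκ hp ν k')
  unfold g183 M183
  exact nadd_le h1 h2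

end Bounds


/-! ## §8. The package handed to the kernel / decay layer -/

/-- **STRIP-REGULARITY PACKAGE FOR THE (1.83) FIBER ENTRIES** (`a = 1`, `U = 1`): a `d`-only half-width
`κ₁₈₃(d) > 0` such that for every lattice parameter `n ≥ 1`, every `0 ≤ κ ≤ κ₁₈₃(d)`, all `μ, ν` and all alias
indices `l, l′`, the continued entry symbol `g183` is holomorphic at every point of `Strip d κ` and bounded there by
the `d`-only constant `M183 d`; and on the punctured real Brillouin zone it IS the printed (1.83) fiber matrix entry
(`B5Prop11Bound.Fiber.G` on `B5Prop11Fiber.balabanFiber`).  This is the analyticity input of «the analyticity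
method of proving an exponential decay» (B5 p. 38) for the kernel of `G = Δ_1⁻¹`; the Paley–Wiener / alias-summation
step is the consumer's.  [cite: Balaban1984PropagatorsI, (1.83)–(1.84) p.31, text p.32–33, p.38 (text only)] [folklore] -/
theorem g183_strip_package (n : ℕ) [NeZero n] :
    0 < kappa183 d ∧
    (∀ κ : ℝ, 0 ≤ κ → κ ≤ kappa183 d → ∀ p ∈ Strip d κ, ∀ (μ ν : Fin d) (k k' : Fin d → Fin n),
        DifferentiableAt ℂ (fun q : Fin d → ℂ => g183 n μ ν k k' q) p ∧ ‖g183 n μ ν k k' p‖ ≤ M183 d) ∧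
    (∀ (hn : 1 ≤ n) (s : Fin d → ℝ) (hs : ∀ μ, |s μ| ≤ Real.pi) (hs0 : s ≠ 0) (μ ν : Fin d)
        (k k' : Fin d → Fin n),
        g183 n μ ν k k' (ofRealVec s) = (balabanFiber n hn 1 one_pos s hs hs0).G (k, μ) (k', ν)) :=
  ⟨kappa183_pos d,
    fun _ h0 h _ hp μ ν k k' => ⟨differentiableAt_g183 n h0 h hp μ ν k k', norm_g183_le n h0 h hp μ ν k k'⟩,
    fun hn s hs hs0 μ ν k k' => g183_ofReal n hn s hs hs0 μ ν k k'⟩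

end Literature.MathematicalPhysics.QuantumFieldTheory.Balaban1983to89.B5G183Strip
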